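import Literature.Analysis.FluidPDE.NSSereginDecayWeightedCubic
import Literature.Analysis.FluidPDE.NSSereginDecayPressureNear
import Literature.Analysis.FluidPDE.NSSereginDecayPressureFar
import Literature.Analysis.FluidPDE.NSSereginDecayCutoff
import Literature.Analysis.FluidPDE.LocalEnergySolutionsOn
import Literature.Analysis.FluidPDE.CKNLocalEnergyEstimate
import HarnessLib

/-!
# Seregin's Lemma B.6: the terms `I₁, I₂, I₃` and the cubic bound (B.2.4), (B.2.8)–(B.2.11)

Analysis/FluidPDE proof file (theorems only) on the discharge path of
`Literature.Analysis.FluidPDE.seregin2014_limit_decay` (Seregin 2014, App. B, Lemma B.6).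
Uniform-in-the-centre bounds used when the local energy inequality (B.2.7) is tested with the
cut-off weight `ψ = χ_R² φ_{x₀}`: finite unit-ball covers of `r`-balls uniformly in the centre,
the bound `Γ(T,A)` for `∫₀ᵀ∫_{B(x₀,r)} |v|³` ((B.2.4) via the multiplicative inequality (B.2.3),
here the tree's `exists_lintegral_cylinder_cube_le`), and Hölder-type splittings of the terms
`I₂` (B.2.9) and `I₃` (B.2.11).

## References

* G. Seregin, *Lecture Notes on Regularity Theory for the Navier–Stokes Equations* (2014),
  doi:10.1142/9314, App. B, (B.2.3)–(B.2.4) and proof of Lemma B.6, (B.2.8)–(B.2.11),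
  PDF pp. 153–154. Bib key `Seregin2014`.
-/

noncomputable section

open MeasureTheory TopologicalSpace Set Function Filter Metric
open _root_.Topology
open scoped ENNReal NNReal RealInnerProductSpace Laplacian

namespace Literature.Analysis.FluidPDE

/-! ### Finite unit-ball covers, uniformly in the centre -/

/-- **Balls of radius `r` are covered by `n_r` unit balls uniformly in the centre**, in the
integrated form: there is `n` such that `∫_{B(x₀,r)} f ≤ n · sup_c ∫_{B(c,1)} f` for every
`f ≥ 0` bounded on unit balls by `A`. [folklore] -/
theorem exists_lintegral_ball_le_mul (r : ℝ) :
    ∃ n : ℕ, ∀ (f : EuclideanSpace ℝ (Fin 3) → ℝ≥0∞) (A : ℝ≥0∞),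
      (∀ c : EuclideanSpace ℝ (Fin 3), ∫⁻ x in ball c 1, f x ≤ A) →
      ∀ x₀ : EuclideanSpace ℝ (Fin 3), ∫⁻ x in ball x₀ r, f x ≤ n * A := by
  obtain ⟨F, hF⟩ := exists_finset_ball_subset_biUnion_ball_one r
  refine ⟨F.card, fun f A hA x₀ => ?_⟩
  exact (lintegral_mono_set (hF x₀)).trans
    (lintegral_biUnion_finset_le_card_mul F _ _ fun c _ => hA (x₀ + c))

/-- The cylinder version: `∫_{I × B(x₀,r)} f ≤ n · sup_c ∫_{I × B(c,1)} f`. [folklore] -/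
theorem exists_lintegral_cylinder_le_mul (r : ℝ) :
    ∃ n : ℕ, ∀ (I : Set ℝ) (f : ℝ × EuclideanSpace ℝ (Fin 3) → ℝ≥0∞) (A : ℝ≥0∞),
      (∀ c : EuclideanSpace ℝ (Fin 3), ∫⁻ z in I ×ˢ ball c 1, f z ≤ A) →
      ∀ x₀ : EuclideanSpace ℝ (Fin 3), ∫⁻ z in I ×ˢ ball x₀ r, f z ≤ n * A := by
  obtain ⟨F, hF⟩ := exists_finset_ball_subset_biUnion_ball_one r
  refine ⟨F.card, fun I f A hA x₀ => ?_⟩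
  have hsub : I ×ˢ ball x₀ r ⊆ ⋃ c ∈ F, I ×ˢ ball (x₀ + c) 1 := by
    intro z hz
    obtain ⟨hz1, hz2⟩ := hz
    have h := hF x₀ hz2
    simp only [mem_iUnion] at h
    obtain ⟨c, hc, hcz⟩ := h
    exact mem_iUnion₂.2 ⟨c, hc, ⟨hz1, hcz⟩⟩
  exact (lintegral_mono_set hsub).trans
    (lintegral_biUnion_finset_le_card_mul F _ _ fun c _ => hA (x₀ + c))

/-! ### The cubic bound `Γ(T, C)` (B.2.4) -/

/-- **Uniform cubic integrability on unit cylinders** ((B.2.4) via (B.2.3)): for `T` and `C`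
there is a finite `Γ₁` such that every field with weak spatial gradient on the slab
`(0,T) × ℝ³`, unit-ball energies `≤ C` at all times of `[0,T]` and unit-cylinder gradient
energies `≤ C`, satisfies `∫₀ᵀ∫_{B(c,1)} |u|³ ≤ Γ₁` for every centre `c` (the tree's cylinder
interpolation `exists_lintegral_cylinder_cube_le` with `u₂ = 0`, `η = 1`).
[cite: Seregin2014, App. B, (B.2.3)–(B.2.4), PDF p. 153] -/
theorem exists_lintegral_unitCylinder_cube_le (T : ℝ) (C : ℝ≥0) :
    ∃ Γ₁ : ℝ≥0, ∀ (u : ℝ → EuclideanSpace ℝ (Fin 3) → EuclideanSpace ℝ (Fin 3))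
      (G : ℝ → EuclideanSpace ℝ (Fin 3) → EuclideanSpace ℝ (Fin 3) →L[ℝ] EuclideanSpace ℝ (Fin 3)),
      HasWeakSpatialGradientOn (slab (EuclideanSpace ℝ (Fin 3)) (Ioo 0 T) isOpen_Ioo) u G →
      (∀ t ∈ Icc 0 T, ∀ x₀ : EuclideanSpace ℝ (Fin 3), ∫⁻ x in ball x₀ 1, ‖u t x‖ₑ ^ 2 ≤ C) →
      (∀ x₀ : EuclideanSpace ℝ (Fin 3),
        ∫⁻ z in Ioo 0 T ×ˢ ball x₀ 1, ENNReal.ofReal (frobeniusNormSq (G z.1 z.2)) ≤ C) →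
      ∀ (t : ℝ), t ≤ T → ∀ c : EuclideanSpace ℝ (Fin 3),
        ∫⁻ z in Ioo 0 t ×ˢ ball c 1, ‖u z.1 z.2‖ₑ ^ 3 ≤ Γ₁ := by
  obtain ⟨Ci, hCi0, hCi⟩ := exists_lintegral_cylinder_cube_le
  -- the bound: `Ci T C^{3/2} + C + Ci⁴ T C³`
  set Γ : ℝ≥0∞ := ENNReal.ofReal Ci * (ENNReal.ofReal (max T 0) * (C : ℝ≥0∞) ^ (3 / 2 : ℝ)) +
    ENNReal.ofReal 1 * C + ENNReal.ofReal (Ci ^ 4 * (1 : ℝ)⁻¹ ^ 3) *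
      (ENNReal.ofReal (max T 0) * (C : ℝ≥0∞) ^ 3) with hΓ
  have hΓtop : Γ ≠ ⊤ := by
    refine ENNReal.add_ne_top.2 ⟨ENNReal.add_ne_top.2 ⟨?_, ?_⟩, ?_⟩
    · exact ENNReal.mul_ne_top ENNReal.ofReal_ne_top (ENNReal.mul_ne_top ENNReal.ofReal_ne_top
        (ENNReal.rpow_ne_top_of_nonneg (by norm_num) ENNReal.coe_ne_top))
    · exact ENNReal.mul_ne_top ENNReal.ofReal_ne_top ENNReal.coe_ne_top
    · exact ENNReal.mul_ne_top ENNReal.ofReal_ne_top (ENNReal.mul_ne_top ENNReal.ofReal_ne_top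
        (ENNReal.pow_ne_top ENNReal.coe_ne_top))
  refine ⟨Γ.toNNReal, fun u G hG huC huG t htT c => ?_⟩
  rw [ENNReal.coe_toNNReal hΓtop]
  have h := hCi hG (hasWeakSpatialGradientOn_zero _) t htT c 1 one_pos
  simp only [Pi.zero_apply, sub_zero] at h
  -- the three quantities
  have hα : ∀ s ∈ Ioo 0 t, ulocEnergy (u s) ≤ C := fun s hs =>
    ulocEnergy_le (huC s ⟨hs.1.le, hs.2.le.trans htT⟩)
  have hI32 : ∫⁻ s in Ioo 0 t, ulocEnergy (u s) ^ (3 / 2 : ℝ) ≤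
      ENNReal.ofReal (max T 0) * (C : ℝ≥0∞) ^ (3 / 2 : ℝ) := by
    calc ∫⁻ s in Ioo 0 t, ulocEnergy (u s) ^ (3 / 2 : ℝ)
        ≤ ∫⁻ _ in Ioo (0 : ℝ) t, (C : ℝ≥0∞) ^ (3 / 2 : ℝ) :=
          setLIntegral_mono measurable_const fun s hs =>
            ENNReal.rpow_le_rpow (hα s hs) (by norm_num)
      _ = (C : ℝ≥0∞) ^ (3 / 2 : ℝ) * ENNReal.ofReal t := by
          rw [setLIntegral_const, Real.volume_Ioo, sub_zero, mul_comm]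
      _ ≤ (C : ℝ≥0∞) ^ (3 / 2 : ℝ) * ENNReal.ofReal (max T 0) :=
          mul_le_mul' le_rfl (ENNReal.ofReal_le_ofReal (htT.trans (le_max_left _ _)))
      _ = _ := mul_comm _ _
  have hI3 : ∫⁻ s in Ioo 0 t, ulocEnergy (u s) ^ 3 ≤ ENNReal.ofReal (max T 0) * (C : ℝ≥0∞) ^ 3 := by
    calc ∫⁻ s in Ioo 0 t, ulocEnergy (u s) ^ 3
        ≤ ∫⁻ _ in Ioo (0 : ℝ) t, (C : ℝ≥0∞) ^ 3 :=
          setLIntegral_mono measurable_const fun s hs => pow_le_pow_left' (hα s hs) 3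
      _ = (C : ℝ≥0∞) ^ 3 * ENNReal.ofReal t := by
          rw [setLIntegral_const, Real.volume_Ioo, sub_zero, mul_comm]
      _ ≤ (C : ℝ≥0∞) ^ 3 * ENNReal.ofReal (max T 0) :=
          mul_le_mul' le_rfl (ENNReal.ofReal_le_ofReal (htT.trans (le_max_left _ _)))
      _ = _ := mul_comm _ _
  have hGr : ulocGradEnergyOn t G ≤ C := by
    refine iSup_le fun x₀ => ?_
    exact (lintegral_mono_set (prod_mono (Ioo_subset_Ioo le_rfl htT) Subset.rfl)).trans (huG x₀)
  refine h.trans ?_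
  rw [hΓ]
  gcongr


/-! ### The pressure pairing of one slice: the gauge drops out -/

/-- **The gauge constant drops out of the pressure pairing** (Seregin 2014, p. 154, the term
`I₄ = 2∫∫ ∇ψ · v p̂` with `p̂ = p − κ`; Kikuchi–Seregin): if on the ball `B = B(d,2)` the slice
pressure expands as `p = p_near + p_far + κ` a.e., the slice velocity is weakly divergence free
against the weight (`∫⟪v, ∇ψ⟫ = 0`) and `∇ψ` vanishes off `B`, then
`‖∫_B p ⟪v, ∇ψ⟫‖ ≤ ∫_B (|p_near| + |p_far|) |v| |∇ψ|`. [cite: Seregin2014, App. B, proof of Lemma B.6, the term I₄ (PDF p. 154)] -/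
theorem enorm_setIntegral_pressure_pairing_le {d : EuclideanSpace ℝ (Fin 3)}
    {pτ near far : EuclideanSpace ℝ (Fin 3) → ℝ} {vτ g : EuclideanSpace ℝ (Fin 3) → EuclideanSpace ℝ (Fin 3)} {κ : ℝ}
    (hexp : ∀ᵐ x ∂(volume.restrict (ball d 2)), pτ x = near x + far x + κ)
    (hint : IntegrableOn (fun x => pτ x * ⟪vτ x, g x⟫) (ball d 2) volume)
    (hvint : Integrable (fun x => ⟪vτ x, g x⟫) volume)
    (hdiv : ∫ x, ⟪vτ x, g x⟫ = 0) (hg : ∀ x ∉ ball d 2, g x = 0) :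
    ‖∫ x in ball d 2, pτ x * ⟪vτ x, g x⟫‖ₑ ≤
      ∫⁻ x in ball d 2, (‖near x‖ₑ + ‖far x‖ₑ) * ‖vτ x‖ₑ * ‖g x‖ₑ := by
  -- `∫_B ⟪v, g⟫ = ∫ ⟪v, g⟫ = 0`
  have hB0 : ∫ x in ball d 2, ⟪vτ x, g x⟫ = 0 := by
    rw [setIntegral_eq_integral_of_forall_compl_eq_zero fun x hx => by rw [hg x hx, inner_zero_right]]
    exact hdiv
  -- `(near + far)⟪v,g⟫ = p⟪v,g⟫ − κ⟪v,g⟫` a.e. on `B`, hence integrable there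
  have hae : (fun x => (near x + far x) * ⟪vτ x, g x⟫) =ᵐ[volume.restrict (ball d 2)]
      fun x => pτ x * ⟪vτ x, g x⟫ - κ * ⟪vτ x, g x⟫ := by
    filter_upwards [hexp] with x hx
    rw [hx]; ring
  have hint' : IntegrableOn (fun x => (near x + far x) * ⟪vτ x, g x⟫) (ball d 2) volume :=
    (hint.sub (hvint.integrableOn.const_mul κ)).congr hae.symm
  have heq : ∫ x in ball d 2, pτ x * ⟪vτ x, g x⟫ = ∫ x in ball d 2, (near x + far x) * ⟪vτ x, g x⟫ := by
    rw [integral_congr_ae hae, integral_sub hint (hvint.integrableOn.const_mul κ), integral_const_mul,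
      hB0, mul_zero, sub_zero]
  rw [heq]
  refine (enorm_integral_le_lintegral_enorm _).trans (lintegral_mono fun x => ?_)
  have hinner : ‖⟪vτ x, g x⟫‖ₑ ≤ ‖vτ x‖ₑ * ‖g x‖ₑ := by
    rw [← ofReal_norm (⟪vτ x, g x⟫), ← ofReal_norm (vτ x), ← ofReal_norm (g x),
      ← ENNReal.ofReal_mul (norm_nonneg _)]
    exact ENNReal.ofReal_le_ofReal (norm_inner_le_norm _ _)
  calc ‖(near x + far x) * ⟪vτ x, g x⟫‖ₑ = ‖near x + far x‖ₑ * ‖⟪vτ x, g x⟫‖ₑ := enorm_mul _ _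
    _ ≤ (‖near x‖ₑ + ‖far x‖ₑ) * (‖vτ x‖ₑ * ‖g x‖ₑ) := mul_le_mul' (enorm_add_le _ _) hinner
    _ = _ := by ring


/-! ### Hölder tools on a set -/

/-- Cauchy–Schwarz against `1` on a set: `∫_S ‖h‖ ≤ |S|^{1/2} (∫_S ‖h‖²)^{1/2}`. [folklore] -/
theorem lintegral_enorm_le_sqrt_measure_mul {F : Type*} [NormedAddCommGroup F]
    {h : EuclideanSpace ℝ (Fin 3) → F} {S : Set (EuclideanSpace ℝ (Fin 3))} (hh : AEStronglyMeasurable h (volume.restrict S)) :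
    ∫⁻ x in S, ‖h x‖ₑ ≤ (volume S) ^ (1 / 2 : ℝ) * (∫⁻ x in S, ‖h x‖ₑ ^ 2) ^ (1 / 2 : ℝ) := by
  have hpq : (2 : ℝ).HolderConjugate 2 := by
    have := Real.holderConjugate_one_div (a := 1 / 2) (b := 1 / 2) (by norm_num) (by norm_num)
      (by norm_num)
    norm_num at this
    exact this
  have h1 := ENNReal.lintegral_mul_le_Lp_mul_Lq (volume.restrict S) hpq
    (aemeasurable_const (b := (1 : ℝ≥0∞))) hh.enorm
  have lhs : ∫⁻ x, ((fun _ : EuclideanSpace ℝ (Fin 3) => (1 : ℝ≥0∞)) * fun x => ‖h x‖ₑ) x ∂(volume.restrict S) =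
      ∫⁻ x in S, ‖h x‖ₑ := lintegral_congr fun x => by simp
  have r1 : ∫⁻ _x, (1 : ℝ≥0∞) ^ (2 : ℝ) ∂(volume.restrict S) = volume S := by
    simp only [ENNReal.one_rpow, lintegral_const, Measure.restrict_apply_univ, one_mul]
  have e2 : ∀ z : ℝ≥0∞, z ^ (2 : ℝ) = z ^ (2 : ℕ) := fun z => by
    rw [show (2 : ℝ) = ((2 : ℕ) : ℝ) by norm_num, ENNReal.rpow_natCast]
  rw [lhs, r1] at h1
  simp only [e2] at h1
  exact h1

/-! ### The two pressure pairings of one slice -/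

/-- **Near-field pairing of one slice** (Seregin 2014, (B.2.14) and the term `I''`, PDF p. 154:
`I' ≤ c J γ_R^{1/3}`, `I'' ≤ c R⁻¹ (∫∫|v|³)^{1/3}(∫∫|p̂|^{3/2})^{2/3}`, slice-wise): if
`‖g‖ ≤ χ_R² B₁ + 2χ_R C₁/R` and `g = 0` off `B(d, 3/2)` (the gradient of the weight
`ψ_d = χ_R² φ₀(d − ·)`), then
`∫_{B(d,2)} |q| |f| |g| ≤ B₁ ‖χ_R q‖_{L^{3/2}(B(d,3/2))} ‖χ_R f‖_{L³(B(d,3/2))}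
  + (2C₁/R) ‖q‖_{L^{3/2}(B(d,3/2))} ‖f‖_{L³(B(d,3/2))}` (Hölder).
[cite: Seregin2014, App. B, proof of Lemma B.6, (B.2.14) and I'' (PDF p. 154)] -/
theorem lintegral_near_pairing_le {R B₁ C₁ : ℝ} (hB₁ : 0 ≤ B₁) (hC₁R : 0 ≤ C₁ / R)
    {d : EuclideanSpace ℝ (Fin 3)} {q : EuclideanSpace ℝ (Fin 3) → ℝ} {f g : EuclideanSpace ℝ (Fin 3) → EuclideanSpace ℝ (Fin 3)}
    (hqm : AEStronglyMeasurable q volume) (hfm : AEStronglyMeasurable f volume)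
    (hgb : ∀ x, ‖g x‖ₑ ≤ ENNReal.ofReal ((1 - cutoff R x) ^ 2 * B₁ + 2 * (1 - cutoff R x) * (C₁ / R)))
    (hg0 : ∀ x ∉ ball d (3 / 2), g x = 0) :
    ∫⁻ x in ball d 2, ‖q x‖ₑ * ‖f x‖ₑ * ‖g x‖ₑ ≤
      ENNReal.ofReal B₁ * (∫⁻ x in ball d (3 / 2), ‖(1 - cutoff R x) * q x‖ₑ ^ (3 / 2 : ℝ)) ^ (2 / 3 : ℝ) *
          (∫⁻ x in ball d (3 / 2), ‖(1 - cutoff R x) • f x‖ₑ ^ 3) ^ (1 / 3 : ℝ) +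
        ENNReal.ofReal (2 * (C₁ / R)) * (∫⁻ x in ball d (3 / 2), ‖q x‖ₑ ^ (3 / 2 : ℝ)) ^ (2 / 3 : ℝ) *
          (∫⁻ x in ball d (3 / 2), ‖f x‖ₑ ^ 3) ^ (1 / 3 : ℝ) := by
  set χ : EuclideanSpace ℝ (Fin 3) → ℝ := fun x => 1 - cutoff R x with hχ
  have hχ01 : ∀ x, 0 ≤ χ x ∧ χ x ≤ 1 := fun x =>
    ⟨sub_nonneg.2 (cutoff_le_one R x), sub_le_self _ (cutoff_nonneg R x)⟩
  have hχc : Continuous χ := continuous_const.sub (contDiff_cutoff (n := 1) R).continuous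
  -- pointwise bound by an indicator
  set H : EuclideanSpace ℝ (Fin 3) → ℝ≥0∞ := fun x => ENNReal.ofReal B₁ * (‖χ x * q x‖ₑ * ‖χ x • f x‖ₑ) +
    ENNReal.ofReal (2 * (C₁ / R)) * (‖q x‖ₑ * ‖f x‖ₑ) with hH
  have hpt : ∀ x, ‖q x‖ₑ * ‖f x‖ₑ * ‖g x‖ₑ ≤ (ball d (3 / 2)).indicator H x := by
    intro x
    by_cases hx : x ∈ ball d (3 / 2)
    · rw [indicator_of_mem hx, hH]
      dsimp only
      have hχx := hχ01 x
      have e1 : ‖χ x * q x‖ₑ * ‖χ x • f x‖ₑ = ENNReal.ofReal (χ x ^ 2) * (‖q x‖ₑ * ‖f x‖ₑ) := by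
        rw [enorm_mul, enorm_smul, Real.enorm_eq_ofReal hχx.1, ENNReal.ofReal_pow hχx.1]
        ring
      rw [e1]
      calc ‖q x‖ₑ * ‖f x‖ₑ * ‖g x‖ₑ
          ≤ ‖q x‖ₑ * ‖f x‖ₑ * ENNReal.ofReal (χ x ^ 2 * B₁ + 2 * χ x * (C₁ / R)) :=
            mul_le_mul' le_rfl (hgb x)
        _ = ‖q x‖ₑ * ‖f x‖ₑ * (ENNReal.ofReal B₁ * ENNReal.ofReal (χ x ^ 2) +
              ENNReal.ofReal (2 * (C₁ / R)) * ENNReal.ofReal (χ x)) := by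
            rw [ENNReal.ofReal_add (mul_nonneg (sq_nonneg _) hB₁)
              (mul_nonneg (mul_nonneg zero_le_two hχx.1) hC₁R), mul_comm (χ x ^ 2) B₁,
              ENNReal.ofReal_mul hB₁, show 2 * χ x * (C₁ / R) = 2 * (C₁ / R) * χ x by ring,
              ENNReal.ofReal_mul (mul_nonneg zero_le_two hC₁R)]
        _ ≤ ‖q x‖ₑ * ‖f x‖ₑ * (ENNReal.ofReal B₁ * ENNReal.ofReal (χ x ^ 2) +
              ENNReal.ofReal (2 * (C₁ / R)) * 1) := by
            gcongr
            exact ENNReal.ofReal_le_one.2 hχx.2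
        _ = _ := by ring
    · rw [indicator_of_notMem hx, hg0 x hx, enorm_zero, mul_zero]
  -- measurability
  have m1 : AEMeasurable (fun x => ‖χ x * q x‖ₑ) (volume.restrict (ball d (3 / 2))) :=
    ((hχc.aestronglyMeasurable.mul hqm).restrict).enorm
  have m2 : AEMeasurable (fun x => ‖χ x • f x‖ₑ) (volume.restrict (ball d (3 / 2))) :=
    ((hχc.aestronglyMeasurable.smul hfm).restrict).enorm
  have m3 : AEMeasurable (fun x => ‖q x‖ₑ) (volume.restrict (ball d (3 / 2))) := hqm.restrict.enorm
  have m4 : AEMeasurable (fun x => ‖f x‖ₑ) (volume.restrict (ball d (3 / 2))) := hfm.restrict.enorm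
  have mA : AEMeasurable (fun x => ENNReal.ofReal B₁ * (‖χ x * q x‖ₑ * ‖χ x • f x‖ₑ))
      (volume.restrict (ball d (3 / 2))) := (m1.mul m2).const_mul _
  calc ∫⁻ x in ball d 2, ‖q x‖ₑ * ‖f x‖ₑ * ‖g x‖ₑ
      ≤ ∫⁻ x in ball d 2, (ball d (3 / 2)).indicator H x := lintegral_mono fun x => hpt x
    _ = ∫⁻ x in ball d (3 / 2) ∩ ball d 2, H x := by
        rw [lintegral_indicator measurableSet_ball, Measure.restrict_restrict measurableSet_ball]
    _ ≤ ∫⁻ x in ball d (3 / 2), H x := lintegral_mono_set inter_subset_left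
    _ = ENNReal.ofReal B₁ * (∫⁻ x in ball d (3 / 2), ‖χ x * q x‖ₑ * ‖χ x • f x‖ₑ) +
          ENNReal.ofReal (2 * (C₁ / R)) * (∫⁻ x in ball d (3 / 2), ‖q x‖ₑ * ‖f x‖ₑ) := by
        rw [hH, lintegral_add_left' mA, lintegral_const_mul' _ _ ENNReal.ofReal_ne_top,
          lintegral_const_mul' _ _ ENNReal.ofReal_ne_top]
    _ ≤ _ := by
        rw [mul_assoc (ENNReal.ofReal B₁), mul_assoc (ENNReal.ofReal (2 * (C₁ / R)))]
        exact add_le_add (mul_le_mul' le_rfl (lintegral_mul_le_threeHalves_three _ m1 m2))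
          (mul_le_mul' le_rfl (lintegral_mul_le_threeHalves_three _ m3 m4))

/-- **Far-field pairing of one slice** (Seregin 2014, (B.2.17)–(B.2.20) inserted in `I'`, `I''`):
with a pointwise bound `χ_R |q| ≤ S` on `B(d,3/2)`,
`∫_{B(d,2)} |q| |f| |g| ≤ B₁ S ∫_{B(d,3/2)} |χ_R f| + (2C₁/R) S ∫_{B(d,3/2)} |f|`.
[cite: Seregin2014, App. B, proof of Lemma B.6, (B.2.17)–(B.2.20) (PDF p. 155)] -/
theorem lintegral_far_pairing_le {R B₁ C₁ : ℝ} (hB₁ : 0 ≤ B₁) (hC₁R : 0 ≤ C₁ / R)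
    {d : EuclideanSpace ℝ (Fin 3)} {q : EuclideanSpace ℝ (Fin 3) → ℝ} {f g : EuclideanSpace ℝ (Fin 3) → EuclideanSpace ℝ (Fin 3)} {S : ℝ≥0∞}
    (hfm : AEStronglyMeasurable f volume)
    (hS : ∀ x ∈ ball d (3 / 2), ENNReal.ofReal (1 - cutoff R x) * ‖q x‖ₑ ≤ S)
    (hgb : ∀ x, ‖g x‖ₑ ≤ ENNReal.ofReal ((1 - cutoff R x) ^ 2 * B₁ + 2 * (1 - cutoff R x) * (C₁ / R)))
    (hg0 : ∀ x ∉ ball d (3 / 2), g x = 0) :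
    ∫⁻ x in ball d 2, ‖q x‖ₑ * ‖f x‖ₑ * ‖g x‖ₑ ≤
      ENNReal.ofReal B₁ * S * (∫⁻ x in ball d (3 / 2), ‖(1 - cutoff R x) • f x‖ₑ) +
        ENNReal.ofReal (2 * (C₁ / R)) * S * (∫⁻ x in ball d (3 / 2), ‖f x‖ₑ) := by
  set χ : EuclideanSpace ℝ (Fin 3) → ℝ := fun x => 1 - cutoff R x with hχ
  have hχ01 : ∀ x, 0 ≤ χ x ∧ χ x ≤ 1 := fun x =>
    ⟨sub_nonneg.2 (cutoff_le_one R x), sub_le_self _ (cutoff_nonneg R x)⟩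
  have hχc : Continuous χ := continuous_const.sub (contDiff_cutoff (n := 1) R).continuous
  set H : EuclideanSpace ℝ (Fin 3) → ℝ≥0∞ := fun x => ENNReal.ofReal B₁ * S * ‖χ x • f x‖ₑ +
    ENNReal.ofReal (2 * (C₁ / R)) * S * ‖f x‖ₑ with hH
  have hpt : ∀ x, ‖q x‖ₑ * ‖f x‖ₑ * ‖g x‖ₑ ≤ (ball d (3 / 2)).indicator H x := by
    intro x
    by_cases hx : x ∈ ball d (3 / 2)
    · rw [indicator_of_mem hx, hH]
      dsimp only
      have hχx := hχ01 x
      have hSx := hS x hx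
      calc ‖q x‖ₑ * ‖f x‖ₑ * ‖g x‖ₑ
          ≤ ‖q x‖ₑ * ‖f x‖ₑ * ENNReal.ofReal (χ x ^ 2 * B₁ + 2 * χ x * (C₁ / R)) :=
            mul_le_mul' le_rfl (hgb x)
        _ = ENNReal.ofReal B₁ * (ENNReal.ofReal (χ x) * ‖q x‖ₑ) * (ENNReal.ofReal (χ x) * ‖f x‖ₑ) +
              ENNReal.ofReal (2 * (C₁ / R)) * (ENNReal.ofReal (χ x) * ‖q x‖ₑ) * ‖f x‖ₑ := by
            rw [ENNReal.ofReal_add (mul_nonneg (sq_nonneg _) hB₁)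
              (mul_nonneg (mul_nonneg zero_le_two hχx.1) hC₁R), mul_comm (χ x ^ 2) B₁,
              ENNReal.ofReal_mul hB₁, show 2 * χ x * (C₁ / R) = 2 * (C₁ / R) * χ x by ring,
              ENNReal.ofReal_mul (mul_nonneg zero_le_two hC₁R), ENNReal.ofReal_pow hχx.1]
            ring
        _ ≤ ENNReal.ofReal B₁ * S * (ENNReal.ofReal (χ x) * ‖f x‖ₑ) +
              ENNReal.ofReal (2 * (C₁ / R)) * S * ‖f x‖ₑ := by
            gcongr
        _ = _ := by rw [enorm_smul, Real.enorm_eq_ofReal hχx.1]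
    · rw [indicator_of_notMem hx, hg0 x hx, enorm_zero, mul_zero]
  have m2 : AEMeasurable (fun x => ‖χ x • f x‖ₑ) (volume.restrict (ball d (3 / 2))) :=
    ((hχc.aestronglyMeasurable.smul hfm).restrict).enorm
  have mA : AEMeasurable (fun x => ENNReal.ofReal B₁ * S * ‖χ x • f x‖ₑ)
      (volume.restrict (ball d (3 / 2))) := m2.const_mul _
  calc ∫⁻ x in ball d 2, ‖q x‖ₑ * ‖f x‖ₑ * ‖g x‖ₑ
      ≤ ∫⁻ x in ball d 2, (ball d (3 / 2)).indicator H x := lintegral_mono fun x => hpt x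
    _ = ∫⁻ x in ball d (3 / 2) ∩ ball d 2, H x := by
        rw [lintegral_indicator measurableSet_ball, Measure.restrict_restrict measurableSet_ball]
    _ ≤ ∫⁻ x in ball d (3 / 2), H x := lintegral_mono_set inter_subset_left
    _ = ENNReal.ofReal B₁ * S * (∫⁻ x in ball d (3 / 2), ‖χ x • f x‖ₑ) +
          ENNReal.ofReal (2 * (C₁ / R)) * S * (∫⁻ x in ball d (3 / 2), ‖f x‖ₑ) := by
        rw [hH, lintegral_add_left' mA, lintegral_const_mul'' _ m2,
          lintegral_const_mul'' _ hfm.restrict.enorm]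


/-! ### Unit-cylinder energies and the cover bounds for the cut-off field -/

/-- `∫₀ˢ∫_{B(y,1)} |u|² ≤ T C` from the every-time unit-ball bound. [folklore] -/
theorem lintegral_unitCylinder_sq_le {T : ℝ} {C : ℝ≥0}
    {u : ℝ → EuclideanSpace ℝ (Fin 3) → EuclideanSpace ℝ (Fin 3)}
    (huC : ∀ t ∈ Icc 0 T, ∀ x₀ : EuclideanSpace ℝ (Fin 3), ∫⁻ x in ball x₀ 1, ‖u t x‖ₑ ^ 2 ≤ C)
    {s : ℝ} (hsT : s ≤ T) (y : EuclideanSpace ℝ (Fin 3)) :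
    ∫⁻ z in Ioo 0 s ×ˢ ball y 1, ‖u z.1 z.2‖ₑ ^ 2 ≤ ENNReal.ofReal T * C := by
  have hprod : (volume.restrict (Ioo (0 : ℝ) s ×ˢ ball y 1) : Measure (ℝ × EuclideanSpace ℝ (Fin 3))) =
      ((volume : Measure ℝ).restrict (Ioo 0 s)).prod
        ((volume : Measure (EuclideanSpace ℝ (Fin 3))).restrict (ball y 1)) := by
    rw [Measure.prod_restrict, ← Measure.volume_eq_prod]
  calc ∫⁻ z in Ioo 0 s ×ˢ ball y 1, ‖u z.1 z.2‖ₑ ^ 2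
      = ∫⁻ z, ‖u z.1 z.2‖ₑ ^ 2 ∂(((volume : Measure ℝ).restrict (Ioo 0 s)).prod
          ((volume : Measure (EuclideanSpace ℝ (Fin 3))).restrict (ball y 1))) := by rw [hprod]
    _ ≤ ∫⁻ τ in Ioo 0 s, ∫⁻ x in ball y 1, ‖u τ x‖ₑ ^ 2 :=
        lintegral_prod_le (fun z : ℝ × EuclideanSpace ℝ (Fin 3) => ‖u z.1 z.2‖ₑ ^ 2)
    _ ≤ ∫⁻ _ in Ioo (0 : ℝ) s, (C : ℝ≥0∞) :=
        setLIntegral_mono measurable_const fun τ hτ => huC τ ⟨hτ.1.le, hτ.2.le.trans hsT⟩ y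
    _ = (C : ℝ≥0∞) * ENNReal.ofReal s := by
        rw [setLIntegral_const, Real.volume_Ioo, sub_zero, mul_comm]
    _ ≤ ENNReal.ofReal T * C := by
        rw [mul_comm]
        exact mul_le_mul' (ENNReal.ofReal_le_ofReal hsT) le_rfl

/-! ### The terms `I₂` and `I₃` of (B.2.7) -/

set_option maxHeartbeats 800000 in
/-- **Seregin's (B.2.9) and (B.2.11) for the tree's weight.** For `T, C, ν ≥ 0` and a bump `φ₀`
with `rOut < 3/2` there is `K = K(T, C, ν, φ₀)` such that for every field `u` with weak spatial
gradient on the slab, unit-ball energies `≤ C` on `[0,T]`, unit-cylinder gradient energies `≤ C`,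
every `R ≥ 1`, centre `d` and `s ∈ (0,T]`:
`∫₀ˢ∫_{B(d,2)} (|u|² ν|Δψ_d| + |u|³ |∇ψ_d|) ≤ K (R⁻¹ + ∫₀ˢ α_R + γ_R(s)^{2/3})`
(`ψ_d = χ_R² φ₀(d − ·)`; `|Δψ| ≤ K_Δ(χ_R² + 1/R)`, `|∇ψ| ≤ χ_R² B₁ + 2χ_R C/R`; the cubic term by
Hölder: "`I₃ ≤ cγ^{1/3}(t)(γ_R^{2/3}(t) + (c/R)γ^{2/3}(t)) ≤ C(T,A)(γ_R^{2/3}(t) + 1/R)`" (B.2.11),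
the quadratic one "`I₂ ≤ c∫₀ᵗα_R ds + C(T,A)/R`" (B.2.9)).
[cite: Seregin2014, App. B, proof of Lemma B.6, (B.2.9) and (B.2.11), PDF p. 154] -/
theorem exists_termI₂I₃_le (T : ℝ) (C : ℝ≥0) {ν : ℝ} (hν : 0 ≤ ν) (φ₀ : ContDiffBump (0 : EuclideanSpace ℝ (Fin 3)))
    (hrOut : φ₀.rOut < 3 / 2) :
    ∃ K : ℝ≥0, ∀ (u : ℝ → EuclideanSpace ℝ (Fin 3) → EuclideanSpace ℝ (Fin 3)) (G : ℝ → EuclideanSpace ℝ (Fin 3) → EuclideanSpace ℝ (Fin 3) →L[ℝ] EuclideanSpace ℝ (Fin 3)),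
      HasWeakSpatialGradientOn (slab (EuclideanSpace ℝ (Fin 3)) (Ioo 0 T) isOpen_Ioo) u G →
      (∀ t ∈ Icc 0 T, ∀ x₀ : EuclideanSpace ℝ (Fin 3), ∫⁻ x in ball x₀ 1, ‖u t x‖ₑ ^ 2 ≤ C) →
      (∀ x₀ : EuclideanSpace ℝ (Fin 3), ∫⁻ z in Ioo 0 T ×ˢ ball x₀ 1, ENNReal.ofReal (frobeniusNormSq (G z.1 z.2)) ≤ C) →
      ∀ (R : ℝ), 1 ≤ R → ∀ (d : EuclideanSpace ℝ (Fin 3)) (s : ℝ), 0 < s → s ≤ T →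
        ∫⁻ z in Ioo 0 s ×ˢ ball d 2, (‖u z.1 z.2‖ₑ ^ 2 *
            ENNReal.ofReal (ν * |(Δ (sereginWeight φ₀ R d)) z.2|) +
          ‖u z.1 z.2‖ₑ ^ 3 * ‖fderiv ℝ (sereginWeight φ₀ R d) z.2‖ₑ) ≤
        K * (ENNReal.ofReal R⁻¹ +
          (∫⁻ τ in Ioo 0 s, ulocEnergy (fun x => (1 - cutoff R x) • u τ x)) +
          (⨆ c : EuclideanSpace ℝ (Fin 3), ∫⁻ z in Ioo 0 s ×ˢ ball c 1,
            ‖(1 - cutoff R z.2) • u z.1 z.2‖ₑ ^ 3) ^ (2 / 3 : ℝ)) := by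
  obtain ⟨KΔ, hKΔ0, hKΔ⟩ := exists_abs_laplacian_sereginWeight_le φ₀
  obtain ⟨B₁, hB₁0, hB₁⟩ := exists_norm_fderiv_bump_comp_sub_le φ₀
  obtain ⟨C₁, hC₁0, hC₁⟩ := exists_norm_fderiv_cutoff_le (E := EuclideanSpace ℝ (Fin 3))
  obtain ⟨nb, hnb⟩ := exists_lintegral_ball_le_mul (3 / 2)
  obtain ⟨nc, hnc⟩ := exists_lintegral_cylinder_le_mul (3 / 2)
  obtain ⟨Γ₁, hΓ₁⟩ := exists_lintegral_unitCylinder_cube_le T C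
  -- the constant
  set c₁ : ℝ≥0∞ := ENNReal.ofReal (ν * KΔ) * nb with hc₁
  set c₂ : ℝ≥0∞ := ENNReal.ofReal (ν * KΔ * 1) * (nc * (ENNReal.ofReal T * C)) with hc₂
  set c₃ : ℝ≥0∞ := ENNReal.ofReal B₁ * ((nc : ℝ≥0∞) ^ (2 / 3 : ℝ) * ((nc : ℝ≥0∞) * Γ₁) ^ (1 / 3 : ℝ))
    with hc₃
  set c₄ : ℝ≥0∞ := ENNReal.ofReal (2 * C₁ * 1) * (nc * Γ₁) with hc₄
  set K : ℝ≥0∞ := c₁ + c₂ + c₃ + c₄ with hK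
  have hnbtop : (nb : ℝ≥0∞) ≠ ⊤ := ENNReal.natCast_ne_top _
  have hnctop : (nc : ℝ≥0∞) ≠ ⊤ := ENNReal.natCast_ne_top _
  have hKtop : K ≠ ⊤ := by
    refine ENNReal.add_ne_top.2 ⟨ENNReal.add_ne_top.2 ⟨ENNReal.add_ne_top.2 ⟨?_, ?_⟩, ?_⟩, ?_⟩
    · exact ENNReal.mul_ne_top ENNReal.ofReal_ne_top hnbtop
    · exact ENNReal.mul_ne_top ENNReal.ofReal_ne_top (ENNReal.mul_ne_top hnctop
        (ENNReal.mul_ne_top ENNReal.ofReal_ne_top ENNReal.coe_ne_top))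
    · exact ENNReal.mul_ne_top ENNReal.ofReal_ne_top (ENNReal.mul_ne_top
        (ENNReal.rpow_ne_top_of_nonneg (by norm_num) hnctop)
        (ENNReal.rpow_ne_top_of_nonneg (by norm_num) (ENNReal.mul_ne_top hnctop ENNReal.coe_ne_top)))
    · exact ENNReal.mul_ne_top ENNReal.ofReal_ne_top (ENNReal.mul_ne_top hnctop ENNReal.coe_ne_top)
  refine ⟨K.toNNReal, ?_⟩
  intro u G hG huC huG R hR d s hs0 hsT
  rw [ENNReal.coe_toNNReal hKtop]
  have hRpos : 0 < R := lt_of_lt_of_le one_pos hR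
  set χ : EuclideanSpace ℝ (Fin 3) → ℝ := fun x => 1 - cutoff R x with hχ
  have hχ01 : ∀ x, 0 ≤ χ x ∧ χ x ≤ 1 := fun x =>
    ⟨sub_nonneg.2 (cutoff_le_one R x), sub_le_self _ (cutoff_nonneg R x)⟩
  have hχs : ContDiff ℝ (⊤ : ℕ∞) χ := contDiff_const.sub (contDiff_cutoff R)
  have hχc : Continuous χ := hχs.continuous
  set ψ := sereginWeight φ₀ R d with hψ
  set αR : ℝ → ℝ≥0∞ := fun τ => ulocEnergy (fun x => χ x • u τ x) with hαR
  set γR : ℝ≥0∞ := ⨆ c : EuclideanSpace ℝ (Fin 3), ∫⁻ z in Ioo 0 s ×ˢ ball c 1, ‖χ z.2 • u z.1 z.2‖ₑ ^ 3 with hγR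
  -- joint measurability of `u` and of `χ u`
  have hmu : AEStronglyMeasurable (uncurry u) (volume.restrict (Ioo 0 T ×ˢ (univ : Set (EuclideanSpace ℝ (Fin 3))))) := by
    have h := hG
    rw [slab_eq_prod_top] at h
    exact h.locallyIntegrableOn.aestronglyMeasurable
  set cyl : Set (ℝ × EuclideanSpace ℝ (Fin 3)) := Ioo 0 s ×ˢ ball d (3 / 2) with hcyl
  have hcyl_sub : cyl ⊆ Ioo 0 T ×ˢ (univ : Set (EuclideanSpace ℝ (Fin 3))) := prod_mono (Ioo_subset_Ioo le_rfl hsT) (subset_univ _)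
  have hmu_c : AEStronglyMeasurable (uncurry u) (volume.restrict cyl) :=
    hmu.mono_measure (Measure.restrict_mono hcyl_sub le_rfl)
  have hmχu_c : AEStronglyMeasurable (fun z : ℝ × EuclideanSpace ℝ (Fin 3) => χ z.2 • u z.1 z.2) (volume.restrict cyl) :=
    (hχc.comp continuous_snd).aestronglyMeasurable.smul hmu_c
  -- pointwise bound of the integrand by an indicator of the smaller cylinder
  set H : ℝ × EuclideanSpace ℝ (Fin 3) → ℝ≥0∞ := fun z =>
    ENNReal.ofReal (ν * KΔ) * ‖χ z.2 • u z.1 z.2‖ₑ ^ 2 +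
      ENNReal.ofReal (ν * KΔ * R⁻¹) * ‖u z.1 z.2‖ₑ ^ 2 +
      ENNReal.ofReal B₁ * (‖χ z.2 • u z.1 z.2‖ₑ ^ 2 * ‖u z.1 z.2‖ₑ) +
      ENNReal.ofReal (2 * C₁ * R⁻¹) * ‖u z.1 z.2‖ₑ ^ 3 with hH
  have hball : closedBall d φ₀.rOut ⊆ ball d (3 / 2) := closedBall_subset_ball hrOut
  have hpt : ∀ z ∈ Ioo 0 s ×ˢ ball d 2,
      ‖u z.1 z.2‖ₑ ^ 2 * ENNReal.ofReal (ν * |(Δ ψ) z.2|) + ‖u z.1 z.2‖ₑ ^ 3 * ‖fderiv ℝ ψ z.2‖ₑ ≤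
        cyl.indicator H z := by
    intro z hz
    by_cases hx : z.2 ∈ ball d (3 / 2)
    · have hzc : z ∈ cyl := ⟨hz.1, hx⟩
      rw [indicator_of_mem hzc, hH]
      dsimp only
      have hχx := hχ01 z.2
      -- the two coefficient bounds
      have hΔ : ENNReal.ofReal (ν * |(Δ ψ) z.2|) ≤
          ENNReal.ofReal (ν * KΔ) * ENNReal.ofReal (χ z.2 ^ 2) + ENNReal.ofReal (ν * KΔ * R⁻¹) := by
        have h1 := hKΔ R hR d z.2
        calc ENNReal.ofReal (ν * |(Δ ψ) z.2|) ≤ ENNReal.ofReal (ν * (KΔ * (χ z.2 ^ 2 + 1 / R))) :=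
              ENNReal.ofReal_le_ofReal (mul_le_mul_of_nonneg_left h1 hν)
          _ = _ := by
              have hνK : 0 ≤ ν * KΔ := mul_nonneg hν hKΔ0
              rw [show ν * (KΔ * (χ z.2 ^ 2 + 1 / R)) = ν * KΔ * χ z.2 ^ 2 + ν * KΔ * R⁻¹ by ring,
                ENNReal.ofReal_add (mul_nonneg hνK (sq_nonneg _)) (mul_nonneg hνK (inv_nonneg.2 hRpos.le)),
                ENNReal.ofReal_mul hνK]
      have hD : ‖fderiv ℝ ψ z.2‖ₑ ≤
          ENNReal.ofReal B₁ * ENNReal.ofReal (χ z.2 ^ 2) + ENNReal.ofReal (2 * C₁ * R⁻¹) := by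
        have h1 := norm_fderiv_sereginWeight_le φ₀ hB₁ (hC₁ R hRpos) d z.2
        have hc0 := cutoff_nonneg R z.2
        have hCR : 0 ≤ C₁ / R := div_nonneg hC₁0 hRpos.le
        have h2 : (1 - cutoff R z.2) ^ 2 * B₁ + 2 * (1 - cutoff R z.2) * (C₁ / R) ≤
            B₁ * (1 - cutoff R z.2) ^ 2 + 2 * C₁ * R⁻¹ := by
          have h3 : 2 * (1 - cutoff R z.2) * (C₁ / R) ≤ 2 * (C₁ / R) := by nlinarith
          rw [div_eq_mul_inv] at h3 ⊢
          nlinarith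
        rw [← ofReal_norm]
        calc ENNReal.ofReal ‖fderiv ℝ ψ z.2‖
            ≤ ENNReal.ofReal (B₁ * (1 - cutoff R z.2) ^ 2 + 2 * C₁ * R⁻¹) :=
              ENNReal.ofReal_le_ofReal (h1.trans h2)
          _ = _ := by
              rw [ENNReal.ofReal_add (mul_nonneg hB₁0 (sq_nonneg _))
                (mul_nonneg (mul_nonneg zero_le_two hC₁0) (inv_nonneg.2 hRpos.le)), ENNReal.ofReal_mul hB₁0]
      have e2 : ‖χ z.2 • u z.1 z.2‖ₑ ^ 2 = ENNReal.ofReal (χ z.2 ^ 2) * ‖u z.1 z.2‖ₑ ^ 2 := by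
        rw [enorm_smul, mul_pow, Real.enorm_eq_ofReal hχx.1, ENNReal.ofReal_pow hχx.1]
      calc ‖u z.1 z.2‖ₑ ^ 2 * ENNReal.ofReal (ν * |(Δ ψ) z.2|) + ‖u z.1 z.2‖ₑ ^ 3 * ‖fderiv ℝ ψ z.2‖ₑ
          ≤ ‖u z.1 z.2‖ₑ ^ 2 * (ENNReal.ofReal (ν * KΔ) * ENNReal.ofReal (χ z.2 ^ 2) +
              ENNReal.ofReal (ν * KΔ * R⁻¹)) +
            ‖u z.1 z.2‖ₑ ^ 3 * (ENNReal.ofReal B₁ * ENNReal.ofReal (χ z.2 ^ 2) +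
              ENNReal.ofReal (2 * C₁ * R⁻¹)) := add_le_add (mul_le_mul' le_rfl hΔ) (mul_le_mul' le_rfl hD)
        _ = _ := by rw [e2]; ring
    · -- off `B(d, 3/2)` both coefficients vanish
      have hx' : z.2 ∉ closedBall d φ₀.rOut := fun h => hx (hball h)
      have hΔ0 : ENNReal.ofReal (ν * |(Δ ψ) z.2|) = 0 := by
        rw [hψ, laplacian_sereginWeight_eq_zero φ₀ R hx', abs_zero, mul_zero, ENNReal.ofReal_zero]
      have hD0 : ‖fderiv ℝ ψ z.2‖ₑ = 0 := by
        rw [hψ, fderiv_sereginWeight_eq_zero φ₀ R hx']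
        exact enorm_zero (E := EuclideanSpace ℝ (Fin 3) →L[ℝ] ℝ)
      rw [hΔ0, hD0, mul_zero, mul_zero, add_zero]
      exact zero_le
  -- integrate
  have mχ2 : AEMeasurable (fun z : ℝ × EuclideanSpace ℝ (Fin 3) => ‖χ z.2 • u z.1 z.2‖ₑ ^ 2) (volume.restrict cyl) :=
    hmχu_c.aemeasurable.enorm.pow_const 2
  have mu2 : AEMeasurable (fun z : ℝ × EuclideanSpace ℝ (Fin 3) => ‖u z.1 z.2‖ₑ ^ 2) (volume.restrict cyl) :=
    hmu_c.aemeasurable.enorm.pow_const 2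
  have mu1 : AEMeasurable (fun z : ℝ × EuclideanSpace ℝ (Fin 3) => ‖u z.1 z.2‖ₑ) (volume.restrict cyl) :=
    hmu_c.aemeasurable.enorm
  have mu3 : AEMeasurable (fun z : ℝ × EuclideanSpace ℝ (Fin 3) => ‖u z.1 z.2‖ₑ ^ 3) (volume.restrict cyl) :=
    hmu_c.aemeasurable.enorm.pow_const 3
  have mT1 : AEMeasurable (fun z : ℝ × EuclideanSpace ℝ (Fin 3) => ENNReal.ofReal (ν * KΔ) * ‖χ z.2 • u z.1 z.2‖ₑ ^ 2)
      (volume.restrict cyl) := mχ2.const_mul _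
  have mT2 : AEMeasurable (fun z : ℝ × EuclideanSpace ℝ (Fin 3) => ENNReal.ofReal (ν * KΔ * R⁻¹) * ‖u z.1 z.2‖ₑ ^ 2)
      (volume.restrict cyl) := mu2.const_mul _
  have mT3 : AEMeasurable (fun z : ℝ × EuclideanSpace ℝ (Fin 3) => ENNReal.ofReal B₁ * (‖χ z.2 • u z.1 z.2‖ₑ ^ 2 * ‖u z.1 z.2‖ₑ))
      (volume.restrict cyl) := (mχ2.mul mu1).const_mul _
  have m12 : AEMeasurable (fun z : ℝ × EuclideanSpace ℝ (Fin 3) => ENNReal.ofReal (ν * KΔ) * ‖χ z.2 • u z.1 z.2‖ₑ ^ 2 +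
      ENNReal.ofReal (ν * KΔ * R⁻¹) * ‖u z.1 z.2‖ₑ ^ 2) (volume.restrict cyl) := mT1.add mT2
  have m123 : AEMeasurable (fun z : ℝ × EuclideanSpace ℝ (Fin 3) => ENNReal.ofReal (ν * KΔ) * ‖χ z.2 • u z.1 z.2‖ₑ ^ 2 +
      ENNReal.ofReal (ν * KΔ * R⁻¹) * ‖u z.1 z.2‖ₑ ^ 2 +
      ENNReal.ofReal B₁ * (‖χ z.2 • u z.1 z.2‖ₑ ^ 2 * ‖u z.1 z.2‖ₑ)) (volume.restrict cyl) := m12.add mT3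
  -- the four cylinder integrals
  have hprod : (volume.restrict cyl : Measure (ℝ × EuclideanSpace ℝ (Fin 3))) =
      ((volume : Measure ℝ).restrict (Ioo 0 s)).prod
        ((volume : Measure (EuclideanSpace ℝ (Fin 3))).restrict (ball d (3 / 2))) := by
    rw [hcyl, Measure.prod_restrict, ← Measure.volume_eq_prod]
  have hT1 : ∫⁻ z in cyl, ‖χ z.2 • u z.1 z.2‖ₑ ^ 2 ≤ nb * ∫⁻ τ in Ioo 0 s, αR τ := by
    calc ∫⁻ z in cyl, ‖χ z.2 • u z.1 z.2‖ₑ ^ 2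
        = ∫⁻ z, ‖χ z.2 • u z.1 z.2‖ₑ ^ 2 ∂(((volume : Measure ℝ).restrict (Ioo 0 s)).prod
            ((volume : Measure (EuclideanSpace ℝ (Fin 3))).restrict (ball d (3 / 2)))) := by rw [hprod]
      _ ≤ ∫⁻ τ in Ioo 0 s, ∫⁻ x in ball d (3 / 2), ‖χ x • u τ x‖ₑ ^ 2 :=
          lintegral_prod_le (fun z : ℝ × EuclideanSpace ℝ (Fin 3) => ‖χ z.2 • u z.1 z.2‖ₑ ^ 2)
      _ ≤ ∫⁻ τ in Ioo 0 s, nb * αR τ :=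
          lintegral_mono fun τ => hnb (fun x => ‖χ x • u τ x‖ₑ ^ 2) (αR τ)
            (fun c => lintegral_ball_le_ulocEnergy (fun x => χ x • u τ x) c) d
      _ = nb * ∫⁻ τ in Ioo 0 s, αR τ := lintegral_const_mul' _ _ hnbtop
  have hT2 : ∫⁻ z in cyl, ‖u z.1 z.2‖ₑ ^ 2 ≤ nc * (ENNReal.ofReal T * C) :=
    hnc (Ioo 0 s) (fun z => ‖u z.1 z.2‖ₑ ^ 2) _
      (fun c => lintegral_unitCylinder_sq_le huC hsT c) d
  have hT3c : ∫⁻ z in cyl, ‖χ z.2 • u z.1 z.2‖ₑ ^ 3 ≤ nc * γR :=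
    hnc (Ioo 0 s) (fun z => ‖χ z.2 • u z.1 z.2‖ₑ ^ 3) γR
      (fun c => le_iSup (fun c : EuclideanSpace ℝ (Fin 3) => ∫⁻ z in Ioo 0 s ×ˢ ball c 1, ‖χ z.2 • u z.1 z.2‖ₑ ^ 3) c) d
  have hT4 : ∫⁻ z in cyl, ‖u z.1 z.2‖ₑ ^ 3 ≤ nc * Γ₁ :=
    hnc (Ioo 0 s) (fun z => ‖u z.1 z.2‖ₑ ^ 3) Γ₁ (fun c => hΓ₁ u G hG huC huG s hsT c) d
  have hT3 : ∫⁻ z in cyl, ‖χ z.2 • u z.1 z.2‖ₑ ^ 2 * ‖u z.1 z.2‖ₑ ≤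
      (nc : ℝ≥0∞) ^ (2 / 3 : ℝ) * ((nc : ℝ≥0∞) * Γ₁) ^ (1 / 3 : ℝ) * γR ^ (2 / 3 : ℝ) := by
    have h := lintegral_mul_le_threeHalves_three (volume.restrict cyl) mχ2 mu1
    have e : ∀ z : ℝ × EuclideanSpace ℝ (Fin 3), (‖χ z.2 • u z.1 z.2‖ₑ ^ 2) ^ (3 / 2 : ℝ) = ‖χ z.2 • u z.1 z.2‖ₑ ^ 3 := by
      intro z
      rw [← ENNReal.rpow_natCast _ 2, ← ENNReal.rpow_mul, show ((2 : ℕ) : ℝ) * (3 / 2) = ((3 : ℕ) : ℝ)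
        by norm_num, ENNReal.rpow_natCast]
    simp only [e] at h
    calc ∫⁻ z in cyl, ‖χ z.2 • u z.1 z.2‖ₑ ^ 2 * ‖u z.1 z.2‖ₑ
        ≤ (∫⁻ z in cyl, ‖χ z.2 • u z.1 z.2‖ₑ ^ 3) ^ (2 / 3 : ℝ) *
            (∫⁻ z in cyl, ‖u z.1 z.2‖ₑ ^ (3 : ℕ)) ^ (1 / 3 : ℝ) := h
      _ ≤ ((nc : ℝ≥0∞) * γR) ^ (2 / 3 : ℝ) * ((nc : ℝ≥0∞) * Γ₁) ^ (1 / 3 : ℝ) := by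
          gcongr
      _ = _ := by
          rw [ENNReal.mul_rpow_of_nonneg _ _ (by norm_num : (0 : ℝ) ≤ 2 / 3)]
          ring
  -- assemble
  calc ∫⁻ z in Ioo 0 s ×ˢ ball d 2, (‖u z.1 z.2‖ₑ ^ 2 * ENNReal.ofReal (ν * |(Δ ψ) z.2|) +
          ‖u z.1 z.2‖ₑ ^ 3 * ‖fderiv ℝ ψ z.2‖ₑ)
      ≤ ∫⁻ z in Ioo 0 s ×ˢ ball d 2, cyl.indicator H z := setLIntegral_mono' (measurableSet_Ioo.prod
          measurableSet_ball) hpt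
    _ = ∫⁻ z in cyl ∩ Ioo 0 s ×ˢ ball d 2, H z := by
        rw [lintegral_indicator (measurableSet_Ioo.prod measurableSet_ball),
          Measure.restrict_restrict (measurableSet_Ioo.prod measurableSet_ball)]
    _ ≤ ∫⁻ z in cyl, H z := lintegral_mono_set inter_subset_left
    _ = ENNReal.ofReal (ν * KΔ) * (∫⁻ z in cyl, ‖χ z.2 • u z.1 z.2‖ₑ ^ 2) +
          ENNReal.ofReal (ν * KΔ * R⁻¹) * (∫⁻ z in cyl, ‖u z.1 z.2‖ₑ ^ 2) +
          ENNReal.ofReal B₁ * (∫⁻ z in cyl, ‖χ z.2 • u z.1 z.2‖ₑ ^ 2 * ‖u z.1 z.2‖ₑ) +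
          ENNReal.ofReal (2 * C₁ * R⁻¹) * (∫⁻ z in cyl, ‖u z.1 z.2‖ₑ ^ 3) := by
        rw [hH, lintegral_add_left' m123, lintegral_add_left' m12, lintegral_add_left' mT1,
          lintegral_const_mul' _ _ ENNReal.ofReal_ne_top, lintegral_const_mul' _ _ ENNReal.ofReal_ne_top,
          lintegral_const_mul' _ _ ENNReal.ofReal_ne_top, lintegral_const_mul' _ _ ENNReal.ofReal_ne_top]
    _ ≤ ENNReal.ofReal (ν * KΔ) * (nb * ∫⁻ τ in Ioo 0 s, αR τ) +
          ENNReal.ofReal (ν * KΔ * R⁻¹) * (nc * (ENNReal.ofReal T * C)) +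
          ENNReal.ofReal B₁ * ((nc : ℝ≥0∞) ^ (2 / 3 : ℝ) * ((nc : ℝ≥0∞) * Γ₁) ^ (1 / 3 : ℝ) *
            γR ^ (2 / 3 : ℝ)) +
          ENNReal.ofReal (2 * C₁ * R⁻¹) * (nc * Γ₁) := by
        gcongr
    _ = c₁ * (∫⁻ τ in Ioo 0 s, αR τ) + c₂ * ENNReal.ofReal R⁻¹ + c₃ * γR ^ (2 / 3 : ℝ) +
          c₄ * ENNReal.ofReal R⁻¹ := by
        have hRi : 0 ≤ R⁻¹ := inv_nonneg.2 hRpos.le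
        rw [hc₁, hc₂, hc₃, hc₄, ENNReal.ofReal_mul (by positivity : 0 ≤ ν * KΔ),
          ENNReal.ofReal_mul (by positivity : 0 ≤ 2 * C₁), ENNReal.ofReal_mul (by positivity : 0 ≤ ν * KΔ),
          ENNReal.ofReal_mul (by positivity : 0 ≤ 2 * C₁), ENNReal.ofReal_one]
        ring
    _ ≤ K * (∫⁻ τ in Ioo 0 s, αR τ) + K * ENNReal.ofReal R⁻¹ + K * γR ^ (2 / 3 : ℝ) := by
        have h1 : c₁ ≤ K := by rw [hK]; exact le_add_right (le_add_right (le_add_right le_rfl))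
        have h2 : c₂ + c₄ ≤ K := by
          rw [hK]
          calc c₂ + c₄ ≤ (c₁ + c₂ + c₃) + c₄ := add_le_add (le_add_right le_add_self) le_rfl
            _ = _ := rfl
        have h3 : c₃ ≤ K := by rw [hK]; exact le_add_right le_add_self
        calc c₁ * (∫⁻ τ in Ioo 0 s, αR τ) + c₂ * ENNReal.ofReal R⁻¹ + c₃ * γR ^ (2 / 3 : ℝ) +
              c₄ * ENNReal.ofReal R⁻¹
            = c₁ * (∫⁻ τ in Ioo 0 s, αR τ) + (c₂ + c₄) * ENNReal.ofReal R⁻¹ + c₃ * γR ^ (2 / 3 : ℝ) := by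
              ring
          _ ≤ K * (∫⁻ τ in Ioo 0 s, αR τ) + K * ENNReal.ofReal R⁻¹ + K * γR ^ (2 / 3 : ℝ) :=
              add_le_add (add_le_add (mul_le_mul' h1 le_rfl) (mul_le_mul' h2 le_rfl)) (mul_le_mul' h3 le_rfl)
    _ = K * (ENNReal.ofReal R⁻¹ + (∫⁻ τ in Ioo 0 s, αR τ) + γR ^ (2 / 3 : ℝ)) := by ring


/-! ### The gradient of the weight -/

/-- `‖∇ψ(x)‖ = ‖Dψ(x)‖` (Riesz isometry). [folklore] -/
theorem norm_gradient_eq_norm_fderiv (f : EuclideanSpace ℝ (Fin 3) → ℝ) (x : EuclideanSpace ℝ (Fin 3)) :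
    ‖gradient f x‖ = ‖fderiv ℝ f x‖ := by
  unfold gradient
  exact (InnerProductSpace.toDual ℝ (EuclideanSpace ℝ (Fin 3))).symm.norm_map _

/-- The gradient bound of the weight in the `ℝ≥0∞` form used by the pairing lemmas. [folklore] -/
theorem enorm_gradient_sereginWeight_le (φ₀ : ContDiffBump (0 : EuclideanSpace ℝ (Fin 3)))
    {B₁ C₁ R : ℝ} (hB₁ : ∀ d x : EuclideanSpace ℝ (Fin 3), ‖fderiv ℝ (fun y => φ₀ (d - y)) x‖ ≤ B₁)
    (hC : ∀ x : EuclideanSpace ℝ (Fin 3), ‖fderiv ℝ (cutoff R) x‖ ≤ C₁ / R)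
    (d x : EuclideanSpace ℝ (Fin 3)) :
    ‖gradient (sereginWeight φ₀ R d) x‖ₑ ≤
      ENNReal.ofReal ((1 - cutoff R x) ^ 2 * B₁ + 2 * (1 - cutoff R x) * (C₁ / R)) := by
  rw [← ofReal_norm, norm_gradient_eq_norm_fderiv]
  exact ENNReal.ofReal_le_ofReal (norm_fderiv_sereginWeight_le φ₀ hB₁ hC d x)

/-- The gradient of the weight vanishes off `B(d, 3/2)` when `rOut < 3/2`. [folklore] -/
theorem gradient_sereginWeight_eq_zero (φ₀ : ContDiffBump (0 : EuclideanSpace ℝ (Fin 3)))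
    (hrOut : φ₀.rOut < 3 / 2) (R : ℝ) (d : EuclideanSpace ℝ (Fin 3))
    {x : EuclideanSpace ℝ (Fin 3)} (hx : x ∉ ball d (3 / 2)) :
    gradient (sereginWeight φ₀ R d) x = 0 := by
  have hx' : x ∉ closedBall d φ₀.rOut := fun h => hx (closedBall_subset_ball hrOut h)
  unfold gradient
  rw [fderiv_sereginWeight_eq_zero φ₀ R hx', map_zero]



/-! ### The far-field part of `I₄`, integrated in time -/

set_option maxHeartbeats 800000 in
/-- **The far-field pressure term of Lemma B.6, integrated in time** (Seregin 2014,
(B.2.17)–(B.2.20) inserted into `I'` and `I''`, `ρ = √R`): there is `K = K(T, C, φ₀)` such that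
for `R ≥ 4`, every centre `d` and `s ∈ (0,T]`,
`∫₀ˢ∫_{B(d,2)} |p_far| |u| |∇ψ_d| ≤ K (R⁻¹ + ∫₀ˢ α_R)` for fields with measurable slices and
unit-ball energies `≤ C` on `[0,T]` (`p_far = localPressureFar d 2 u τ`; pointwise
`χ_R|p_far| ≤ K_f(ρ⁻¹α + (ρ/R)α + α_R^{1/2}α^{1/2})` on `B(d,3/2)`, Cauchy–Schwarz on `B(d,3/2)`,
and `2R^{-1/2}α_R^{1/2} ≤ R⁻¹ + α_R`). [cite: Seregin2014, App. B, proof of Lemma B.6, (B.2.17)–(B.2.20), PDF p. 155] -/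
theorem exists_farTerm_le (T : ℝ) (C : ℝ≥0) (φ₀ : ContDiffBump (0 : EuclideanSpace ℝ (Fin 3))) (hrOut : φ₀.rOut < 3 / 2) :
    ∃ K : ℝ≥0, ∀ (u : ℝ → EuclideanSpace ℝ (Fin 3) → EuclideanSpace ℝ (Fin 3)),
      (∀ t ∈ Icc 0 T, AEStronglyMeasurable (u t) volume) →
      (∀ t ∈ Icc 0 T, ∀ x₀ : EuclideanSpace ℝ (Fin 3), ∫⁻ x in ball x₀ 1, ‖u t x‖ₑ ^ 2 ≤ C) →
      ∀ (R : ℝ), 4 ≤ R → ∀ (d : EuclideanSpace ℝ (Fin 3)) (s : ℝ), 0 < s → s ≤ T →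
        ∃ c₁ c₂ : ℝ≥0∞, c₁ ≠ ⊤ ∧ c₂ ≠ ⊤ ∧
          (∀ τ ∈ Ioo 0 s, ∫⁻ x in ball d 2, ‖localPressureFar d 2 u τ x‖ₑ * ‖u τ x‖ₑ *
              ‖gradient (sereginWeight φ₀ R d) x‖ₑ ≤
            c₁ * ulocEnergy (fun x => (1 - cutoff R x) • u τ x) + c₂) ∧
          c₁ * (∫⁻ τ in Ioo 0 s, ulocEnergy (fun x => (1 - cutoff R x) • u τ x)) + c₂ * ENNReal.ofReal s ≤
            K * (ENNReal.ofReal R⁻¹ + ∫⁻ τ in Ioo 0 s, ulocEnergy (fun x => (1 - cutoff R x) • u τ x)) := by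
  obtain ⟨B₁, hB₁0, hB₁⟩ := exists_norm_fderiv_bump_comp_sub_le φ₀
  obtain ⟨C₁, hC₁0, hC₁⟩ := exists_norm_fderiv_cutoff_le (E := EuclideanSpace ℝ (Fin 3))
  obtain ⟨Kf, hKf⟩ := exists_one_sub_cutoff_mul_enorm_localPressureFar_le
  obtain ⟨nb, hnb⟩ := exists_lintegral_ball_le_mul (3 / 2)
  set V : ℝ≥0∞ := volume (ball (0 : EuclideanSpace ℝ (Fin 3)) (3 / 2)) with hV
  have hVtop : V ≠ ⊤ := measure_ball_lt_top.ne
  -- constants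
  set c₀ : ℝ≥0∞ := ENNReal.ofReal B₁ * (Kf : ℝ≥0∞) * (V ^ (1 / 2 : ℝ) * ((nb : ℝ≥0∞)) ^ (1 / 2 : ℝ))
    with hc₀
  set cα : ℝ≥0∞ := c₀ * (2 * (C : ℝ≥0∞) + (C : ℝ≥0∞) ^ (1 / 2 : ℝ)) with hcα
  set cR : ℝ≥0∞ := c₀ * (2 * (C : ℝ≥0∞)) +
    ENNReal.ofReal (2 * C₁) * ((Kf : ℝ≥0∞) * (3 * (C : ℝ≥0∞))) *
      (V ^ (1 / 2 : ℝ) * ((nb : ℝ≥0∞) * C) ^ (1 / 2 : ℝ)) with hcR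
  set K : ℝ≥0∞ := cα + cR * ENNReal.ofReal T with hK
  have hnbtop : (nb : ℝ≥0∞) ≠ ⊤ := ENNReal.natCast_ne_top _
  have hV12 : V ^ (1 / 2 : ℝ) ≠ ⊤ := ENNReal.rpow_ne_top_of_nonneg (by norm_num) hVtop
  have hc₀top : c₀ ≠ ⊤ := ENNReal.mul_ne_top (ENNReal.mul_ne_top ENNReal.ofReal_ne_top ENNReal.coe_ne_top)
    (ENNReal.mul_ne_top hV12 (ENNReal.rpow_ne_top_of_nonneg (by norm_num) hnbtop))
  have hCtop : (C : ℝ≥0∞) ^ (1 / 2 : ℝ) ≠ ⊤ := ENNReal.rpow_ne_top_of_nonneg (by norm_num) ENNReal.coe_ne_top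
  have hcαtop : cα ≠ ⊤ := ENNReal.mul_ne_top hc₀top (ENNReal.add_ne_top.2
    ⟨ENNReal.mul_ne_top (by norm_num) ENNReal.coe_ne_top, hCtop⟩)
  have hcRtop : cR ≠ ⊤ := by
    refine ENNReal.add_ne_top.2 ⟨ENNReal.mul_ne_top hc₀top (ENNReal.mul_ne_top (by norm_num)
      ENNReal.coe_ne_top), ?_⟩
    exact ENNReal.mul_ne_top (ENNReal.mul_ne_top ENNReal.ofReal_ne_top (ENNReal.mul_ne_top
      ENNReal.coe_ne_top (ENNReal.mul_ne_top (by norm_num) ENNReal.coe_ne_top)))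
      (ENNReal.mul_ne_top hV12 (ENNReal.rpow_ne_top_of_nonneg (by norm_num)
        (ENNReal.mul_ne_top hnbtop ENNReal.coe_ne_top)))
  have hKtop : K ≠ ⊤ := ENNReal.add_ne_top.2 ⟨hcαtop, ENNReal.mul_ne_top hcRtop ENNReal.ofReal_ne_top⟩
  refine ⟨K.toNNReal, ?_⟩
  intro u hum huC R hR d s hs0 hsT
  rw [ENNReal.coe_toNNReal hKtop]
  have hR1 : 1 ≤ R := by linarith
  have hRpos : 0 < R := by linarith
  set χ : EuclideanSpace ℝ (Fin 3) → ℝ := fun x => 1 - cutoff R x with hχ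
  have hχ01 : ∀ x, 0 ≤ χ x ∧ χ x ≤ 1 := fun x =>
    ⟨sub_nonneg.2 (cutoff_le_one R x), sub_le_self _ (cutoff_nonneg R x)⟩
  have hχc : Continuous χ := continuous_const.sub (contDiff_cutoff (n := 1) R).continuous
  set αR : ℝ → ℝ≥0∞ := fun τ => ulocEnergy (fun x => χ x • u τ x) with hαR
  -- `ρ = √R`
  set ρ : ℝ := Real.sqrt R with hρ
  have hρ2 : 2 ≤ ρ := by
    rw [hρ, show (2 : ℝ) = Real.sqrt 4 by rw [show (4 : ℝ) = 2 ^ 2 by norm_num, Real.sqrt_sq (by norm_num)]]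
    exact Real.sqrt_le_sqrt hR
  have hρpos : 0 < ρ := by linarith
  set εR : ℝ≥0∞ := ENNReal.ofReal ρ⁻¹ with hεR
  have hRρ : R = ρ * ρ := by rw [hρ, Real.mul_self_sqrt hRpos.le]
  have hρR : ρ / R = ρ⁻¹ := by
    rw [hRρ]; field_simp
  have hεR1 : εR ≤ 1 := ENNReal.ofReal_le_one.2 (by
    rw [inv_le_comm₀ hρpos one_pos, inv_one]; linarith)
  have hεR2 : εR ^ 2 = ENNReal.ofReal R⁻¹ := by
    rw [hεR, ← ENNReal.ofReal_pow (inv_nonneg.2 hρpos.le), inv_pow, sq, ← hRρ]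
  -- elementary: `ab ≤ a² + b²`
  have pp : ∀ a b : ℝ≥0∞, a * b ≤ a ^ 2 + b ^ 2 := by
    intro a b
    rcases le_total a b with h | h
    · calc a * b ≤ b * b := mul_le_mul' h le_rfl
        _ = b ^ 2 := (sq b).symm
        _ ≤ a ^ 2 + b ^ 2 := le_add_self
    · calc a * b ≤ a * a := mul_le_mul' le_rfl h
        _ = a ^ 2 := (sq a).symm
        _ ≤ a ^ 2 + b ^ 2 := le_self_add
  -- `α_R ≤ C` on `[0,T]`
  have hαC : ∀ t ∈ Icc 0 T, αR t ≤ C := by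
    intro t ht
    refine ulocEnergy_le fun z => (lintegral_mono fun x => ?_).trans (huC t ht z)
    rw [enorm_smul, Real.enorm_eq_ofReal (hχ01 x).1]
    calc (ENNReal.ofReal (χ x) * ‖u t x‖ₑ) ^ 2 ≤ (1 * ‖u t x‖ₑ) ^ 2 := by
          gcongr; exact ENNReal.ofReal_le_one.2 (hχ01 x).2
      _ = ‖u t x‖ₑ ^ 2 := by rw [one_mul]
  -- the slice bound
  have hslice : ∀ τ ∈ Ioo 0 s,
      ∫⁻ x in ball d 2, ‖localPressureFar d 2 u τ x‖ₑ * ‖u τ x‖ₑ *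
          ‖gradient (sereginWeight φ₀ R d) x‖ₑ ≤ cα * αR τ + cR * ENNReal.ofReal R⁻¹ := by
    intro τ hτ
    have hτI : τ ∈ Icc 0 T := ⟨hτ.1.le, hτ.2.le.trans hsT⟩
    have humτ := hum τ hτI
    have hα : ∀ z : EuclideanSpace ℝ (Fin 3), ∫⁻ y in ball z 1, ‖u τ y‖ₑ ^ (2 : ℕ) ≤ (C : ℝ≥0∞) := huC τ hτI
    have hαRz : ∀ z : EuclideanSpace ℝ (Fin 3), ∫⁻ y in ball z 1, ENNReal.ofReal ((1 - cutoff R y) ^ 2) * ‖u τ y‖ₑ ^ (2 : ℕ) ≤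
        αR τ := by
      intro z
      refine (lintegral_congr fun y => ?_).trans_le (lintegral_ball_le_ulocEnergy (fun x => χ x • u τ x) z)
      rw [enorm_smul, mul_pow, Real.enorm_eq_ofReal (hχ01 y).1, ENNReal.ofReal_pow (hχ01 y).1]
    set S : ℝ≥0∞ := (Kf : ℝ≥0∞) * (ENNReal.ofReal ρ⁻¹ * C + ENNReal.ofReal (ρ / R) * C +
      αR τ ^ (1 / 2 : ℝ) * (C : ℝ≥0∞) ^ (1 / 2 : ℝ)) with hS
    have hSx : ∀ x ∈ ball d (3 / 2), ENNReal.ofReal (1 - cutoff R x) * ‖localPressureFar d 2 u τ x‖ₑ ≤ S :=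
      fun x hx => hKf R hR1 ρ hρ2 d u τ humτ hα hαRz hx
    have hpair := lintegral_far_pairing_le hB₁0 (div_nonneg hC₁0 hRpos.le) humτ hSx
      (enorm_gradient_sereginWeight_le φ₀ hB₁ (hC₁ R hRpos) d)
      (fun x hx => gradient_sereginWeight_eq_zero φ₀ hrOut R d hx)
    -- Cauchy–Schwarz on `B(d, 3/2)`
    have hVd : volume (ball d (3 / 2)) = V := Measure.addHaar_ball_center volume d (3 / 2)
    have hCS1 : ∫⁻ x in ball d (3 / 2), ‖(1 - cutoff R x) • u τ x‖ₑ ≤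
        V ^ (1 / 2 : ℝ) * ((nb : ℝ≥0∞) * αR τ) ^ (1 / 2 : ℝ) := by
      have hm : AEStronglyMeasurable (fun x => χ x • u τ x) (volume.restrict (ball d (3 / 2))) :=
        (hχc.aestronglyMeasurable.smul humτ).restrict
      refine (lintegral_enorm_le_sqrt_measure_mul hm).trans ?_
      rw [hVd]
      refine mul_le_mul' le_rfl (ENNReal.rpow_le_rpow ?_ (by norm_num))
      exact hnb (fun x => ‖χ x • u τ x‖ₑ ^ 2) (αR τ)
        (fun c => lintegral_ball_le_ulocEnergy (fun x => χ x • u τ x) c) d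
    have hCS2 : ∫⁻ x in ball d (3 / 2), ‖u τ x‖ₑ ≤ V ^ (1 / 2 : ℝ) * ((nb : ℝ≥0∞) * C) ^ (1 / 2 : ℝ) := by
      refine (lintegral_enorm_le_sqrt_measure_mul humτ.restrict).trans ?_
      rw [hVd]
      refine mul_le_mul' le_rfl (ENNReal.rpow_le_rpow ?_ (by norm_num))
      exact hnb (fun x => ‖u τ x‖ₑ ^ 2) C hα d
    -- the two bounds for `S`
    have hS1 : S = (Kf : ℝ≥0∞) * (2 * (C : ℝ≥0∞) * εR + αR τ ^ (1 / 2 : ℝ) * (C : ℝ≥0∞) ^ (1 / 2 : ℝ)) := by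
      rw [hS, hρR, hεR]; ring
    have hαC12 : αR τ ^ (1 / 2 : ℝ) ≤ (C : ℝ≥0∞) ^ (1 / 2 : ℝ) :=
      ENNReal.rpow_le_rpow (hαC τ hτI) (by norm_num)
    have hCC : (C : ℝ≥0∞) ^ (1 / 2 : ℝ) * (C : ℝ≥0∞) ^ (1 / 2 : ℝ) = C := by
      rw [← ENNReal.rpow_add_of_nonneg _ _ (by norm_num) (by norm_num)]; norm_num
    have hS2 : S ≤ (Kf : ℝ≥0∞) * (3 * (C : ℝ≥0∞)) := by
      rw [hS1]
      refine mul_le_mul' le_rfl ?_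
      calc 2 * (C : ℝ≥0∞) * εR + αR τ ^ (1 / 2 : ℝ) * (C : ℝ≥0∞) ^ (1 / 2 : ℝ)
          ≤ 2 * (C : ℝ≥0∞) * 1 + (C : ℝ≥0∞) ^ (1 / 2 : ℝ) * (C : ℝ≥0∞) ^ (1 / 2 : ℝ) :=
            add_le_add (mul_le_mul' le_rfl hεR1) (mul_le_mul' hαC12 le_rfl)
        _ = 3 * C := by rw [hCC]; ring
    -- term 1
    have hαhalf : (αR τ ^ (1 / 2 : ℝ)) ^ 2 = αR τ := by
      rw [← ENNReal.rpow_natCast, ← ENNReal.rpow_mul]; norm_num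
    have ht1 : ENNReal.ofReal B₁ * S * (V ^ (1 / 2 : ℝ) * ((nb : ℝ≥0∞) * αR τ) ^ (1 / 2 : ℝ)) ≤
        c₀ * (2 * (C : ℝ≥0∞)) * ENNReal.ofReal R⁻¹ + cα * αR τ := by
      rw [hS1, ENNReal.mul_rpow_of_nonneg _ _ (by norm_num : (0 : ℝ) ≤ 1 / 2)]
      have hkey : (2 * (C : ℝ≥0∞) * εR + αR τ ^ (1 / 2 : ℝ) * (C : ℝ≥0∞) ^ (1 / 2 : ℝ)) * αR τ ^ (1 / 2 : ℝ) ≤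
          2 * (C : ℝ≥0∞) * ENNReal.ofReal R⁻¹ + (2 * (C : ℝ≥0∞) + (C : ℝ≥0∞) ^ (1 / 2 : ℝ)) * αR τ := by
        have h1 := pp εR (αR τ ^ (1 / 2 : ℝ))
        rw [hαhalf, hεR2] at h1
        calc (2 * (C : ℝ≥0∞) * εR + αR τ ^ (1 / 2 : ℝ) * (C : ℝ≥0∞) ^ (1 / 2 : ℝ)) * αR τ ^ (1 / 2 : ℝ)
            = 2 * (C : ℝ≥0∞) * (εR * αR τ ^ (1 / 2 : ℝ)) +
                (C : ℝ≥0∞) ^ (1 / 2 : ℝ) * (αR τ ^ (1 / 2 : ℝ)) ^ 2 := by ring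
          _ ≤ 2 * (C : ℝ≥0∞) * (ENNReal.ofReal R⁻¹ + αR τ) + (C : ℝ≥0∞) ^ (1 / 2 : ℝ) * αR τ := by
              rw [hαhalf]; exact add_le_add (mul_le_mul' le_rfl h1) le_rfl
          _ = _ := by ring
      calc ENNReal.ofReal B₁ * ((Kf : ℝ≥0∞) * (2 * (C : ℝ≥0∞) * εR + αR τ ^ (1 / 2 : ℝ) * (C : ℝ≥0∞) ^ (1 / 2 : ℝ))) *
            (V ^ (1 / 2 : ℝ) * (((nb : ℝ≥0∞)) ^ (1 / 2 : ℝ) * αR τ ^ (1 / 2 : ℝ)))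
          = c₀ * ((2 * (C : ℝ≥0∞) * εR + αR τ ^ (1 / 2 : ℝ) * (C : ℝ≥0∞) ^ (1 / 2 : ℝ)) * αR τ ^ (1 / 2 : ℝ)) := by
            rw [hc₀]; ring
        _ ≤ c₀ * (2 * (C : ℝ≥0∞) * ENNReal.ofReal R⁻¹ + (2 * (C : ℝ≥0∞) + (C : ℝ≥0∞) ^ (1 / 2 : ℝ)) * αR τ) :=
            mul_le_mul' le_rfl hkey
        _ = _ := by rw [hcα]; ring
    -- term 2
    have ht2 : ENNReal.ofReal (2 * (C₁ / R)) * S * (V ^ (1 / 2 : ℝ) * ((nb : ℝ≥0∞) * C) ^ (1 / 2 : ℝ)) ≤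
        ENNReal.ofReal (2 * C₁) * ((Kf : ℝ≥0∞) * (3 * (C : ℝ≥0∞))) *
          (V ^ (1 / 2 : ℝ) * ((nb : ℝ≥0∞) * C) ^ (1 / 2 : ℝ)) * ENNReal.ofReal R⁻¹ := by
      have e : ENNReal.ofReal (2 * (C₁ / R)) = ENNReal.ofReal (2 * C₁) * ENNReal.ofReal R⁻¹ := by
        rw [← ENNReal.ofReal_mul (by positivity), div_eq_mul_inv, mul_assoc]
      rw [e]
      calc ENNReal.ofReal (2 * C₁) * ENNReal.ofReal R⁻¹ * S * (V ^ (1 / 2 : ℝ) * ((nb : ℝ≥0∞) * C) ^ (1 / 2 : ℝ))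
          ≤ ENNReal.ofReal (2 * C₁) * ENNReal.ofReal R⁻¹ * ((Kf : ℝ≥0∞) * (3 * (C : ℝ≥0∞))) *
              (V ^ (1 / 2 : ℝ) * ((nb : ℝ≥0∞) * C) ^ (1 / 2 : ℝ)) :=
            mul_le_mul' (mul_le_mul' le_rfl hS2) le_rfl
        _ = _ := by ring
    calc ∫⁻ x in ball d 2, ‖localPressureFar d 2 u τ x‖ₑ * ‖u τ x‖ₑ * ‖gradient (sereginWeight φ₀ R d) x‖ₑ
        ≤ ENNReal.ofReal B₁ * S * (∫⁻ x in ball d (3 / 2), ‖(1 - cutoff R x) • u τ x‖ₑ) +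
            ENNReal.ofReal (2 * (C₁ / R)) * S * (∫⁻ x in ball d (3 / 2), ‖u τ x‖ₑ) := hpair
      _ ≤ ENNReal.ofReal B₁ * S * (V ^ (1 / 2 : ℝ) * ((nb : ℝ≥0∞) * αR τ) ^ (1 / 2 : ℝ)) +
            ENNReal.ofReal (2 * (C₁ / R)) * S * (V ^ (1 / 2 : ℝ) * ((nb : ℝ≥0∞) * C) ^ (1 / 2 : ℝ)) :=
          add_le_add (mul_le_mul' le_rfl hCS1) (mul_le_mul' le_rfl hCS2)
      _ ≤ (c₀ * (2 * (C : ℝ≥0∞)) * ENNReal.ofReal R⁻¹ + cα * αR τ) +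
            ENNReal.ofReal (2 * C₁) * ((Kf : ℝ≥0∞) * (3 * (C : ℝ≥0∞))) *
              (V ^ (1 / 2 : ℝ) * ((nb : ℝ≥0∞) * C) ^ (1 / 2 : ℝ)) * ENNReal.ofReal R⁻¹ := add_le_add ht1 ht2
      _ = cα * αR τ + cR * ENNReal.ofReal R⁻¹ := by rw [hcR]; ring
  -- the integrated form
  refine ⟨cα, cR * ENNReal.ofReal R⁻¹, hcαtop, ENNReal.mul_ne_top hcRtop ENNReal.ofReal_ne_top, hslice, ?_⟩
  calc cα * (∫⁻ τ in Ioo 0 s, αR τ) + cR * ENNReal.ofReal R⁻¹ * ENNReal.ofReal s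
      ≤ cα * (∫⁻ τ in Ioo 0 s, αR τ) + cR * ENNReal.ofReal R⁻¹ * ENNReal.ofReal T :=
        add_le_add le_rfl (mul_le_mul' le_rfl (ENNReal.ofReal_le_ofReal hsT))
    _ ≤ K * (∫⁻ τ in Ioo 0 s, αR τ) + K * ENNReal.ofReal R⁻¹ := by
        have h1 : cα ≤ K := by rw [hK]; exact le_self_add
        have h2 : cR * ENNReal.ofReal T ≤ K := by rw [hK]; exact le_add_self
        calc cα * (∫⁻ τ in Ioo 0 s, αR τ) + cR * ENNReal.ofReal R⁻¹ * ENNReal.ofReal T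
            = cα * (∫⁻ τ in Ioo 0 s, αR τ) + cR * ENNReal.ofReal T * ENNReal.ofReal R⁻¹ := by ring
          _ ≤ _ := add_le_add (mul_le_mul' h1 le_rfl) (mul_le_mul' h2 le_rfl)
    _ = K * (ENNReal.ofReal R⁻¹ + ∫⁻ τ in Ioo 0 s, αR τ) := by ring


/-! ### Tonelli on time–space cylinders -/

/-- Tonelli on `(0,s) × B`: the cylinder integral is the iterated one, and the inner integral is
a.e.-measurable in time. [folklore] -/
theorem lintegral_cylinder_eq_iterate {s : ℝ} {B : Set (EuclideanSpace ℝ (Fin 3))}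
    {h : ℝ × EuclideanSpace ℝ (Fin 3) → ℝ≥0∞} (hh : AEMeasurable h (volume.restrict (Ioo 0 s ×ˢ B))) :
    (∫⁻ z in Ioo 0 s ×ˢ B, h z = ∫⁻ τ in Ioo 0 s, ∫⁻ x in B, h (τ, x)) ∧
      AEMeasurable (fun τ => ∫⁻ x in B, h (τ, x)) (volume.restrict (Ioo 0 s)) := by
  have hprod : (volume.restrict (Ioo (0 : ℝ) s ×ˢ B) : Measure (ℝ × EuclideanSpace ℝ (Fin 3))) =
      ((volume : Measure ℝ).restrict (Ioo 0 s)).prod ((volume : Measure (EuclideanSpace ℝ (Fin 3))).restrict B) := by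
    rw [Measure.prod_restrict, ← Measure.volume_eq_prod]
  rw [hprod] at hh ⊢
  exact ⟨lintegral_prod _ hh, hh.lintegral_prod_right'⟩

/-! ### The near-field part of `I₄`, integrated in time -/

set_option maxHeartbeats 1600000 in
/-- **The near-field pressure term of Lemma B.6, integrated in time** (Seregin 2014,
(B.2.14)–(B.2.16) and (B.2.21)–(B.2.22)): there is `K = K(T, C, φ₀)` such that for `R ≥ 1`,
every centre `d` and `s ∈ (0,T]`,
`∫₀ˢ∫_{B(d,2)} |p_near| |u| |∇ψ_d| ≤ K (R⁻¹ + γ_R(s)^{2/3})` for fields with weak spatial gradient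
on the slab, measurable slices, unit-ball energies `≤ C` on `[0,T]` and unit-cylinder gradient
energies `≤ C` (`p_near = localPressureNear d 2 u τ`; slice-wise Hölder `(3/2,3)`, the
Calderón–Zygmund slice bound, Hölder `(3/2,3)` and Cauchy–Schwarz in time, the cubic bound
`Γ(T,C)`: "`J₁ ≤ C(T,A)(1/R + γ_R^{1/3}(t))`" (B.2.16), "`I'' ≤ C(T,A)/R`" (B.2.13)).
[cite: Seregin2014, App. B, proof of Lemma B.6, (B.2.13)–(B.2.16), PDF pp. 154–155] -/
theorem exists_nearTerm_le (T : ℝ) (C : ℝ≥0) (φ₀ : ContDiffBump (0 : EuclideanSpace ℝ (Fin 3))) (hrOut : φ₀.rOut < 3 / 2) :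
    ∃ K : ℝ≥0, ∀ (u : ℝ → EuclideanSpace ℝ (Fin 3) → EuclideanSpace ℝ (Fin 3)) (G : ℝ → EuclideanSpace ℝ (Fin 3) → EuclideanSpace ℝ (Fin 3) →L[ℝ] EuclideanSpace ℝ (Fin 3)),
      HasWeakSpatialGradientOn (slab (EuclideanSpace ℝ (Fin 3)) (Ioo 0 T) isOpen_Ioo) u G →
      (∀ t ∈ Icc 0 T, AEStronglyMeasurable (u t) volume) →
      (∀ t ∈ Icc 0 T, ∀ x₀ : EuclideanSpace ℝ (Fin 3), ∫⁻ x in ball x₀ 1, ‖u t x‖ₑ ^ 2 ≤ C) →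
      (∀ x₀ : EuclideanSpace ℝ (Fin 3), ∫⁻ z in Ioo 0 T ×ˢ ball x₀ 1, ENNReal.ofReal (frobeniusNormSq (G z.1 z.2)) ≤ C) →
      ∀ (R : ℝ), 1 ≤ R → ∀ (d : EuclideanSpace ℝ (Fin 3)) (s : ℝ), 0 < s → s ≤ T →
        ∀ (Φ : ℝ → ℝ≥0∞), (∀ᵐ τ ∂(volume.restrict (Ioo 0 s)), τ ∈ Ioo 0 s →
          Φ τ ≤ ∫⁻ x in ball d 2, ‖localPressureNear d 2 u τ x‖ₑ * ‖u τ x‖ₑ *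
            ‖gradient (sereginWeight φ₀ R d) x‖ₑ) →
        ∫⁻ τ in Ioo 0 s, Φ τ ≤
        K * (ENNReal.ofReal R⁻¹ +
          (⨆ c : EuclideanSpace ℝ (Fin 3), ∫⁻ z in Ioo 0 s ×ˢ ball c 1,
            ‖(1 - cutoff R z.2) • u z.1 z.2‖ₑ ^ 3) ^ (2 / 3 : ℝ)) := by
  obtain ⟨B₁, hB₁0, hB₁⟩ := exists_norm_fderiv_bump_comp_sub_le φ₀
  obtain ⟨C₁, hC₁0, hC₁⟩ := exists_norm_fderiv_cutoff_le (E := EuclideanSpace ℝ (Fin 3))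
  obtain ⟨CL, hCL0, hCL⟩ := exists_abs_one_sub_cutoff_sub_le
  obtain ⟨CN, hCN⟩ := exists_lintegral_cutoff_mul_localPressureNear_rpow_le
  obtain ⟨nc, hnc⟩ := exists_lintegral_cylinder_le_mul (3 / 2)
  obtain ⟨n₄, hn₄⟩ := exists_lintegral_cylinder_le_mul 4
  obtain ⟨nb₄, hnb₄⟩ := exists_lintegral_ball_le_mul 4
  obtain ⟨Γ₁, hΓ₁⟩ := exists_lintegral_unitCylinder_cube_le T C
  -- constants
  set cn : ℝ≥0∞ := (CN : ℝ≥0∞) ^ (2 / 3 : ℝ) with hcn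
  set k₁ : ℝ≥0∞ := ENNReal.ofReal B₁ * cn * (((n₄ : ℝ≥0∞) * (nc : ℝ≥0∞)) ^ (1 / 3 : ℝ) *
    ((n₄ : ℝ≥0∞) * Γ₁) ^ (1 / 3 : ℝ)) with hk₁
  set k₂ : ℝ≥0∞ := ENNReal.ofReal B₁ * cn * (ENNReal.ofReal CL * ((n₄ : ℝ≥0∞) * Γ₁) ^ (2 / 3 : ℝ) *
    ((nc : ℝ≥0∞) * Γ₁) ^ (1 / 3 : ℝ)) with hk₂
  set k₃ : ℝ≥0∞ := ENNReal.ofReal (2 * C₁) * (cn * ((n₄ : ℝ≥0∞) * Γ₁) ^ (2 / 3 : ℝ) *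
    ((nc : ℝ≥0∞) * Γ₁) ^ (1 / 3 : ℝ)) with hk₃
  set K : ℝ≥0∞ := k₁ + k₂ + k₃ with hK
  have hfin : ∀ {x : ℝ≥0∞}, x ≠ ⊤ → ∀ r : ℝ, 0 ≤ r → x ^ r ≠ ⊤ := fun hx r hr =>
    ENNReal.rpow_ne_top_of_nonneg hr hx
  have hnctop : (nc : ℝ≥0∞) ≠ ⊤ := ENNReal.natCast_ne_top _
  have hn₄top : (n₄ : ℝ≥0∞) ≠ ⊤ := ENNReal.natCast_ne_top _
  have hcntop : cn ≠ ⊤ := hfin ENNReal.coe_ne_top _ (by norm_num)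
  have hG1 : ((n₄ : ℝ≥0∞) * Γ₁) ≠ ⊤ := ENNReal.mul_ne_top hn₄top ENNReal.coe_ne_top
  have hG2 : ((nc : ℝ≥0∞) * Γ₁) ≠ ⊤ := ENNReal.mul_ne_top hnctop ENNReal.coe_ne_top
  have hKtop : K ≠ ⊤ := by
    refine ENNReal.add_ne_top.2 ⟨ENNReal.add_ne_top.2 ⟨?_, ?_⟩, ?_⟩
    · exact ENNReal.mul_ne_top (ENNReal.mul_ne_top ENNReal.ofReal_ne_top hcntop)
        (ENNReal.mul_ne_top (hfin (ENNReal.mul_ne_top hn₄top hnctop) _ (by norm_num)) (hfin hG1 _ (by norm_num)))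
    · exact ENNReal.mul_ne_top (ENNReal.mul_ne_top ENNReal.ofReal_ne_top hcntop)
        (ENNReal.mul_ne_top (ENNReal.mul_ne_top ENNReal.ofReal_ne_top (hfin hG1 _ (by norm_num)))
          (hfin hG2 _ (by norm_num)))
    · exact ENNReal.mul_ne_top ENNReal.ofReal_ne_top (ENNReal.mul_ne_top
        (ENNReal.mul_ne_top hcntop (hfin hG1 _ (by norm_num))) (hfin hG2 _ (by norm_num)))
  refine ⟨K.toNNReal, ?_⟩
  intro u G hG hum huC huG R hR d s hs0 hsT Φ hΦ
  rw [ENNReal.coe_toNNReal hKtop]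
  have hRpos : 0 < R := lt_of_lt_of_le one_pos hR
  set χ : EuclideanSpace ℝ (Fin 3) → ℝ := fun x => 1 - cutoff R x with hχ
  have hχ01 : ∀ x, 0 ≤ χ x ∧ χ x ≤ 1 := fun x =>
    ⟨sub_nonneg.2 (cutoff_le_one R x), sub_le_self _ (cutoff_nonneg R x)⟩
  have hχc : Continuous χ := continuous_const.sub (contDiff_cutoff (n := 1) R).continuous
  have hχL : ∀ x y, |χ x - χ y| ≤ CL / R * ‖x - y‖ := hCL R hRpos
  set γR : ℝ≥0∞ := ⨆ c : EuclideanSpace ℝ (Fin 3), ∫⁻ z in Ioo 0 s ×ˢ ball c 1, ‖χ z.2 • u z.1 z.2‖ₑ ^ 3 with hγR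
  -- joint measurability
  have hmu : AEStronglyMeasurable (uncurry u) (volume.restrict (Ioo 0 T ×ˢ (univ : Set (EuclideanSpace ℝ (Fin 3))))) := by
    have h := hG
    rw [slab_eq_prod_top] at h
    exact h.locallyIntegrableOn.aestronglyMeasurable
  have hmu_on : ∀ B : Set (EuclideanSpace ℝ (Fin 3)), AEStronglyMeasurable (uncurry u) (volume.restrict (Ioo 0 s ×ˢ B)) :=
    fun B => hmu.mono_measure (Measure.restrict_mono (prod_mono (Ioo_subset_Ioo le_rfl hsT) (subset_univ _)) le_rfl)
  have hmχu_on : ∀ B : Set (EuclideanSpace ℝ (Fin 3)), AEStronglyMeasurable (fun z : ℝ × EuclideanSpace ℝ (Fin 3) => χ z.2 • u z.1 z.2)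
      (volume.restrict (Ioo 0 s ×ˢ B)) := fun B => (hχc.comp continuous_snd).aestronglyMeasurable.smul (hmu_on B)
  -- the four time functions
  set X : ℝ → ℝ≥0∞ := fun τ => ∫⁻ x in ball d 4, ENNReal.ofReal (χ x ^ (3 / 2 : ℝ)) * ‖u τ x‖ₑ ^ (3 : ℕ) with hX
  set Y : ℝ → ℝ≥0∞ := fun τ => ∫⁻ x in ball d 4, ‖u τ x‖ₑ ^ (3 : ℕ) with hY
  set g₁ : ℝ → ℝ≥0∞ := fun τ => ∫⁻ x in ball d (3 / 2), ‖χ x • u τ x‖ₑ ^ 3 with hg₁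
  set g₂ : ℝ → ℝ≥0∞ := fun τ => ∫⁻ x in ball d (3 / 2), ‖u τ x‖ₑ ^ 3 with hg₂
  have hχ32m : Measurable fun x : EuclideanSpace ℝ (Fin 3) => ENNReal.ofReal (χ x ^ (3 / 2 : ℝ)) :=
    ENNReal.measurable_ofReal.comp ((hχc.measurable).pow_const _)
  obtain ⟨hXeq, hXm⟩ := lintegral_cylinder_eq_iterate (s := s) (B := ball d 4)
    (h := fun z => ENNReal.ofReal (χ z.2 ^ (3 / 2 : ℝ)) * ‖u z.1 z.2‖ₑ ^ (3 : ℕ))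
    ((hχ32m.comp measurable_snd).aemeasurable.mul ((hmu_on _).aemeasurable.enorm.pow_const 3))
  obtain ⟨hYeq, hYm⟩ := lintegral_cylinder_eq_iterate (s := s) (B := ball d 4)
    (h := fun z => ‖u z.1 z.2‖ₑ ^ (3 : ℕ)) ((hmu_on _).aemeasurable.enorm.pow_const 3)
  obtain ⟨hg₁eq, hg₁m⟩ := lintegral_cylinder_eq_iterate (s := s) (B := ball d (3 / 2))
    (h := fun z => ‖χ z.2 • u z.1 z.2‖ₑ ^ 3) ((hmχu_on _).aemeasurable.enorm.pow_const 3)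
  obtain ⟨hg₂eq, hg₂m⟩ := lintegral_cylinder_eq_iterate (s := s) (B := ball d (3 / 2))
    (h := fun z => ‖u z.1 z.2‖ₑ ^ 3) ((hmu_on _).aemeasurable.enorm.pow_const 3)
  -- cylinder bounds
  have hγΓ : γR ≤ Γ₁ := by
    refine iSup_le fun c => (lintegral_mono fun z => ?_).trans (hΓ₁ u G hG huC huG s hsT c)
    rw [enorm_smul, Real.enorm_eq_ofReal (hχ01 z.2).1]
    calc (ENNReal.ofReal (χ z.2) * ‖u z.1 z.2‖ₑ) ^ 3 ≤ (1 * ‖u z.1 z.2‖ₑ) ^ 3 := by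
          gcongr; exact ENNReal.ofReal_le_one.2 (hχ01 z.2).2
      _ = ‖u z.1 z.2‖ₑ ^ 3 := by rw [one_mul]
  have hYbar : ∫⁻ z in Ioo 0 s ×ˢ ball d 4, ‖u z.1 z.2‖ₑ ^ (3 : ℕ) ≤ (n₄ : ℝ≥0∞) * Γ₁ :=
    hn₄ (Ioo 0 s) (fun z => ‖u z.1 z.2‖ₑ ^ 3) Γ₁ (fun c => hΓ₁ u G hG huC huG s hsT c) d
  have hγ4 : ∫⁻ z in Ioo 0 s ×ˢ ball d 4, ‖χ z.2 • u z.1 z.2‖ₑ ^ 3 ≤ (n₄ : ℝ≥0∞) * γR :=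
    hn₄ (Ioo 0 s) (fun z => ‖χ z.2 • u z.1 z.2‖ₑ ^ 3) γR
      (fun c => le_iSup (fun c : EuclideanSpace ℝ (Fin 3) => ∫⁻ z in Ioo 0 s ×ˢ ball c 1, ‖χ z.2 • u z.1 z.2‖ₑ ^ 3) c) d
  have hg₁bar : ∫⁻ τ in Ioo 0 s, g₁ τ ≤ (nc : ℝ≥0∞) * γR := by
    rw [hg₁]; dsimp only; rw [← hg₁eq]
    exact hnc (Ioo 0 s) (fun z => ‖χ z.2 • u z.1 z.2‖ₑ ^ 3) γR
      (fun c => le_iSup (fun c : EuclideanSpace ℝ (Fin 3) => ∫⁻ z in Ioo 0 s ×ˢ ball c 1, ‖χ z.2 • u z.1 z.2‖ₑ ^ 3) c) d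
  have hg₂bar : ∫⁻ τ in Ioo 0 s, g₂ τ ≤ (nc : ℝ≥0∞) * Γ₁ := by
    rw [hg₂]; dsimp only; rw [← hg₂eq]
    exact hnc (Ioo 0 s) (fun z => ‖u z.1 z.2‖ₑ ^ 3) Γ₁ (fun c => hΓ₁ u G hG huC huG s hsT c) d
  have hYbar' : ∫⁻ τ in Ioo 0 s, Y τ ≤ (n₄ : ℝ≥0∞) * Γ₁ := by
    rw [hY]; dsimp only; rw [← hYeq]; exact hYbar
  -- Cauchy–Schwarz for `X̄`
  have hXbar : ∫⁻ τ in Ioo 0 s, X τ ≤ ((n₄ : ℝ≥0∞) * γR) ^ (1 / 2 : ℝ) * ((n₄ : ℝ≥0∞) * Γ₁) ^ (1 / 2 : ℝ) := by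
    rw [hX]; dsimp only; rw [← hXeq]
    set μ := volume.restrict (Ioo 0 s ×ˢ ball d 4) with hμ
    set f : ℝ × EuclideanSpace ℝ (Fin 3) → ℝ≥0∞ := fun z => ‖χ z.2 • u z.1 z.2‖ₑ ^ (3 / 2 : ℝ) with hf
    set g : ℝ × EuclideanSpace ℝ (Fin 3) → ℝ≥0∞ := fun z => ‖u z.1 z.2‖ₑ ^ (3 / 2 : ℝ) with hg
    have hfm : AEMeasurable f μ := (hmχu_on _).aemeasurable.enorm.pow_const _
    have hgm : AEMeasurable g μ := (hmu_on _).aemeasurable.enorm.pow_const _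
    have hpq : (2 : ℝ).HolderConjugate 2 := by
      have := Real.holderConjugate_one_div (a := 1 / 2) (b := 1 / 2) (by norm_num) (by norm_num)
        (by norm_num)
      norm_num at this
      exact this
    have hH := ENNReal.lintegral_mul_le_Lp_mul_Lq μ hpq hfm hgm
    have e32 : ∀ x : ℝ≥0∞, (x ^ (3 / 2 : ℝ)) ^ (2 : ℝ) = x ^ (3 : ℕ) := fun x => by
      rw [← ENNReal.rpow_mul, show (3 / 2 : ℝ) * 2 = ((3 : ℕ) : ℝ) by norm_num, ENNReal.rpow_natCast]
    have e32n : ∀ x : ℝ≥0∞, (x ^ (3 / 2 : ℝ)) ^ 2 = x ^ (3 : ℕ) := fun x => by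
      rw [← ENNReal.rpow_natCast _ 2, ← ENNReal.rpow_mul, show (3 / 2 : ℝ) * ((2 : ℕ) : ℝ) = ((3 : ℕ) : ℝ) by norm_num,
        ENNReal.rpow_natCast]
    have hfg : ∀ z : ℝ × EuclideanSpace ℝ (Fin 3), ENNReal.ofReal (χ z.2 ^ (3 / 2 : ℝ)) * ‖u z.1 z.2‖ₑ ^ (3 : ℕ) = (f * g) z := by
      intro z
      simp only [hf, hg, Pi.mul_apply]
      rw [enorm_smul, ENNReal.mul_rpow_of_nonneg _ _ (by norm_num : (0 : ℝ) ≤ 3 / 2),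
        Real.enorm_eq_ofReal (hχ01 z.2).1, ENNReal.ofReal_rpow_of_nonneg (hχ01 z.2).1 (by norm_num),
        mul_assoc, ← sq, e32n]
    calc ∫⁻ z, ENNReal.ofReal (χ z.2 ^ (3 / 2 : ℝ)) * ‖u z.1 z.2‖ₑ ^ (3 : ℕ) ∂μ
        = ∫⁻ z, (f * g) z ∂μ := lintegral_congr fun z => hfg z
      _ ≤ (∫⁻ z, f z ^ (2 : ℝ) ∂μ) ^ (1 / (2 : ℝ)) * (∫⁻ z, g z ^ (2 : ℝ) ∂μ) ^ (1 / (2 : ℝ)) := hH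
      _ = (∫⁻ z, ‖χ z.2 • u z.1 z.2‖ₑ ^ (3 : ℕ) ∂μ) ^ (1 / 2 : ℝ) *
            (∫⁻ z, ‖u z.1 z.2‖ₑ ^ (3 : ℕ) ∂μ) ^ (1 / 2 : ℝ) := by
          simp only [hf, hg, e32]
      _ ≤ _ := by
          gcongr
  -- a.e. `τ`: `Y τ < ∞`
  have hYae : ∀ᵐ τ ∂(volume.restrict (Ioo 0 s)), Y τ < ⊤ :=
    ae_lt_top' hYm (ne_top_of_le_ne_top hG1 hYbar')
  -- the a.e. slice bound
  have hslice : ∀ᵐ τ ∂(volume.restrict (Ioo 0 s)), τ ∈ Ioo 0 s →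
      ∫⁻ x in ball d 2, ‖localPressureNear d 2 u τ x‖ₑ * ‖u τ x‖ₑ * ‖gradient (sereginWeight φ₀ R d) x‖ₑ ≤
        ENNReal.ofReal B₁ * ((CN : ℝ≥0∞) * (X τ + ENNReal.ofReal ((CL / R) ^ (3 / 2 : ℝ)) * Y τ)) ^ (2 / 3 : ℝ) *
            g₁ τ ^ (1 / 3 : ℝ) +
          ENNReal.ofReal (2 * (C₁ / R)) * ((CN : ℝ≥0∞) * Y τ) ^ (2 / 3 : ℝ) * g₂ τ ^ (1 / 3 : ℝ) := by
    filter_upwards [hYae] with τ hYτ hτ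
    have hτI : τ ∈ Icc 0 T := ⟨hτ.1.le, hτ.2.le.trans hsT⟩
    have humτ := hum τ hτI
    have hYne : ∫⁻ x in ball d 4, ‖u τ x‖ₑ ^ (3 : ℕ) ≠ ⊤ := hYτ.ne
    -- measurability of the near slice
    set w : EuclideanSpace ℝ (Fin 3) → EuclideanSpace ℝ (Fin 3) := (ball d (2 * 2)).indicator (u τ) with hw
    have hq_eq : localPressureNear d 2 u τ = normalisedPressure w := funext fun x => localPressureNear_apply _ _ _ _ _
    have hwm : AEStronglyMeasurable w volume := humτ.indicator measurableSet_ball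
    have hw2 : Integrable (fun y => ‖w y‖ ^ 2) volume := by
      have hball4 : ball d (2 * 2) = ball d 4 := by norm_num
      have hfinsq : ∫⁻ x in ball d 4, ‖u τ x‖ₑ ^ 2 < ⊤ := by
        refine lt_of_le_of_lt (hnb₄ (fun x => ‖u τ x‖ₑ ^ 2) C (huC τ hτI) d) ?_
        exact ENNReal.mul_lt_top (ENNReal.natCast_lt_top _) ENNReal.coe_lt_top
      have hint : IntegrableOn (fun y => ‖u τ y‖ ^ 2) (ball d 4) volume := by
        refine ⟨(continuous_norm.pow 2).comp_aestronglyMeasurable humτ.restrict, ?_⟩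
        refine (hasFiniteIntegral_iff_enorm.2 ?_)
        refine lt_of_le_of_lt (lintegral_mono fun y => le_of_eq ?_) hfinsq
        rw [Real.enorm_eq_ofReal (sq_nonneg _), ENNReal.ofReal_pow (norm_nonneg _), ofReal_norm]
      have h := hint.integrable_indicator measurableSet_ball
      refine h.congr (Eventually.of_forall fun y => ?_)
      show (ball d 4).indicator (fun y => ‖u τ y‖ ^ 2) y = ‖w y‖ ^ 2
      rw [hw, hball4]
      by_cases hy : y ∈ ball d 4
      · rw [indicator_of_mem hy, indicator_of_mem hy]
      · rw [indicator_of_notMem hy, indicator_of_notMem hy, norm_zero]; ring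
    have hqm : AEStronglyMeasurable (localPressureNear d 2 u τ) volume := by
      rw [hq_eq]; exact aestronglyMeasurable_normalisedPressure_of_sq_integrable hwm hw2
    -- pairing and the two CZ bounds
    have hpair := lintegral_near_pairing_le hB₁0 (div_nonneg hC₁0 hRpos.le) hqm humτ
      (enorm_gradient_sereginWeight_le φ₀ hB₁ (hC₁ R hRpos) d)
      (fun x hx => gradient_sereginWeight_eq_zero φ₀ hrOut R d hx)
    have hCZ1 := hCN χ (CL / R) hχc hχ01 (div_nonneg hCL0 hRpos.le) hχL d u τ humτ hYne
    have hCZ2' := hCN (fun _ => (1 : ℝ)) 0 continuous_const (fun _ => ⟨zero_le_one, le_rfl⟩) le_rfl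
      (fun x y => by simp) d u τ humτ hYne
    have hCZ2 : ∫⁻ x in ball d (3 / 2), ‖localPressureNear d 2 u τ x‖ₑ ^ (3 / 2 : ℝ) ≤ (CN : ℝ≥0∞) * Y τ := by
      simp only [Real.one_rpow, ENNReal.ofReal_one, one_mul, Real.zero_rpow (by norm_num : (3 / 2 : ℝ) ≠ 0),
        ENNReal.ofReal_zero, zero_mul, add_zero] at hCZ2'
      exact hCZ2'
    calc ∫⁻ x in ball d 2, ‖localPressureNear d 2 u τ x‖ₑ * ‖u τ x‖ₑ * ‖gradient (sereginWeight φ₀ R d) x‖ₑ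
        ≤ ENNReal.ofReal B₁ * (∫⁻ x in ball d (3 / 2), ‖(1 - cutoff R x) * localPressureNear d 2 u τ x‖ₑ ^ (3 / 2 : ℝ)) ^ (2 / 3 : ℝ) *
              (∫⁻ x in ball d (3 / 2), ‖(1 - cutoff R x) • u τ x‖ₑ ^ 3) ^ (1 / 3 : ℝ) +
            ENNReal.ofReal (2 * (C₁ / R)) * (∫⁻ x in ball d (3 / 2), ‖localPressureNear d 2 u τ x‖ₑ ^ (3 / 2 : ℝ)) ^ (2 / 3 : ℝ) *
              (∫⁻ x in ball d (3 / 2), ‖u τ x‖ₑ ^ 3) ^ (1 / 3 : ℝ) := hpair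
      _ ≤ _ := by
          gcongr
  -- integrate the slice bound
  have hF₁m : AEMeasurable (fun τ => ((CN : ℝ≥0∞) * (X τ + ENNReal.ofReal ((CL / R) ^ (3 / 2 : ℝ)) * Y τ)) ^ (2 / 3 : ℝ) *
      g₁ τ ^ (1 / 3 : ℝ)) (volume.restrict (Ioo 0 s)) :=
    (((hXm.add (hYm.const_mul _)).const_mul _).pow_const _).mul (hg₁m.pow_const _)
  have hF₂m : AEMeasurable (fun τ => ((CN : ℝ≥0∞) * Y τ) ^ (2 / 3 : ℝ) * g₂ τ ^ (1 / 3 : ℝ))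
      (volume.restrict (Ioo 0 s)) := ((hYm.const_mul _).pow_const _).mul (hg₂m.pow_const _)
  have hT1m : AEMeasurable (fun τ => ENNReal.ofReal B₁ * ((CN : ℝ≥0∞) * (X τ + ENNReal.ofReal ((CL / R) ^ (3 / 2 : ℝ)) * Y τ)) ^ (2 / 3 : ℝ) *
      g₁ τ ^ (1 / 3 : ℝ)) (volume.restrict (Ioo 0 s)) := by
    have := hF₁m.const_mul (ENNReal.ofReal B₁)
    refine this.congr (Eventually.of_forall fun τ => ?_)
    dsimp only
    ring
  -- Hölder in time (generic form)
  have hHt : ∀ {F g : ℝ → ℝ≥0∞}, AEMeasurable F (volume.restrict (Ioo 0 s)) → AEMeasurable g (volume.restrict (Ioo 0 s)) →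
      ∫⁻ τ in Ioo 0 s, F τ ^ (2 / 3 : ℝ) * g τ ^ (1 / 3 : ℝ) ≤
        (∫⁻ τ in Ioo 0 s, F τ) ^ (2 / 3 : ℝ) * (∫⁻ τ in Ioo 0 s, g τ) ^ (1 / 3 : ℝ) := by
    intro F g hFm hgm
    have h := lintegral_mul_le_threeHalves_three (volume.restrict (Ioo 0 s)) (hFm.pow_const (2 / 3 : ℝ))
      (hgm.pow_const (1 / 3 : ℝ))
    have e1 : ∀ τ, (F τ ^ (2 / 3 : ℝ)) ^ (3 / 2 : ℝ) = F τ := fun τ => by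
      rw [← ENNReal.rpow_mul]; norm_num
    have e2 : ∀ τ, (g τ ^ (1 / 3 : ℝ)) ^ (3 : ℕ) = g τ := fun τ => by
      rw [← ENNReal.rpow_natCast, ← ENNReal.rpow_mul]; norm_num
    simp only [e1, e2] at h
    exact h
  have hcL : (ENNReal.ofReal ((CL / R) ^ (3 / 2 : ℝ))) ^ (2 / 3 : ℝ) = ENNReal.ofReal CL * ENNReal.ofReal R⁻¹ := by
    rw [ENNReal.ofReal_rpow_of_nonneg (by positivity) (by norm_num), ← Real.rpow_mul (by positivity),
      show (3 / 2 : ℝ) * (2 / 3) = 1 by norm_num, Real.rpow_one, div_eq_mul_inv,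
      ENNReal.ofReal_mul hCL0]
  -- term 1
  have hterm1 : ∫⁻ τ in Ioo 0 s, ENNReal.ofReal B₁ *
      ((CN : ℝ≥0∞) * (X τ + ENNReal.ofReal ((CL / R) ^ (3 / 2 : ℝ)) * Y τ)) ^ (2 / 3 : ℝ) * g₁ τ ^ (1 / 3 : ℝ) ≤
      k₁ * γR ^ (2 / 3 : ℝ) + k₂ * ENNReal.ofReal R⁻¹ := by
    have hF : AEMeasurable (fun τ => (CN : ℝ≥0∞) * (X τ + ENNReal.ofReal ((CL / R) ^ (3 / 2 : ℝ)) * Y τ))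
        (volume.restrict (Ioo 0 s)) := (hXm.add (hYm.const_mul _)).const_mul _
    have h1 := hHt hF hg₁m
    have hIF : ∫⁻ τ in Ioo 0 s, (CN : ℝ≥0∞) * (X τ + ENNReal.ofReal ((CL / R) ^ (3 / 2 : ℝ)) * Y τ) ≤
        (CN : ℝ≥0∞) * (((n₄ : ℝ≥0∞) * γR) ^ (1 / 2 : ℝ) * ((n₄ : ℝ≥0∞) * Γ₁) ^ (1 / 2 : ℝ) +
          ENNReal.ofReal ((CL / R) ^ (3 / 2 : ℝ)) * ((n₄ : ℝ≥0∞) * Γ₁)) := by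
      have hXYm : AEMeasurable (fun τ => X τ + ENNReal.ofReal ((CL / R) ^ (3 / 2 : ℝ)) * Y τ)
          (volume.restrict (Ioo 0 s)) := hXm.add (hYm.const_mul _)
      rw [lintegral_const_mul'' _ hXYm, lintegral_add_left' hXm, lintegral_const_mul'' _ hYm]
      exact mul_le_mul' le_rfl (add_le_add hXbar (mul_le_mul' le_rfl hYbar'))
    calc ∫⁻ τ in Ioo 0 s, ENNReal.ofReal B₁ *
          ((CN : ℝ≥0∞) * (X τ + ENNReal.ofReal ((CL / R) ^ (3 / 2 : ℝ)) * Y τ)) ^ (2 / 3 : ℝ) * g₁ τ ^ (1 / 3 : ℝ)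
        = ENNReal.ofReal B₁ * ∫⁻ τ in Ioo 0 s,
            ((CN : ℝ≥0∞) * (X τ + ENNReal.ofReal ((CL / R) ^ (3 / 2 : ℝ)) * Y τ)) ^ (2 / 3 : ℝ) * g₁ τ ^ (1 / 3 : ℝ) := by
          rw [← lintegral_const_mul' _ _ ENNReal.ofReal_ne_top]
          refine lintegral_congr fun τ => ?_
          ring
      _ ≤ ENNReal.ofReal B₁ * ((∫⁻ τ in Ioo 0 s, (CN : ℝ≥0∞) * (X τ + ENNReal.ofReal ((CL / R) ^ (3 / 2 : ℝ)) * Y τ)) ^ (2 / 3 : ℝ) *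
            (∫⁻ τ in Ioo 0 s, g₁ τ) ^ (1 / 3 : ℝ)) := mul_le_mul' le_rfl h1
      _ ≤ ENNReal.ofReal B₁ * (((CN : ℝ≥0∞) * (((n₄ : ℝ≥0∞) * γR) ^ (1 / 2 : ℝ) * ((n₄ : ℝ≥0∞) * Γ₁) ^ (1 / 2 : ℝ) +
              ENNReal.ofReal ((CL / R) ^ (3 / 2 : ℝ)) * ((n₄ : ℝ≥0∞) * Γ₁))) ^ (2 / 3 : ℝ) *
            ((nc : ℝ≥0∞) * γR) ^ (1 / 3 : ℝ)) := by
          gcongr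
      _ ≤ ENNReal.ofReal B₁ * (cn * ((((n₄ : ℝ≥0∞) * γR) ^ (1 / 2 : ℝ) * ((n₄ : ℝ≥0∞) * Γ₁) ^ (1 / 2 : ℝ)) ^ (2 / 3 : ℝ) +
              (ENNReal.ofReal ((CL / R) ^ (3 / 2 : ℝ)) * ((n₄ : ℝ≥0∞) * Γ₁)) ^ (2 / 3 : ℝ)) *
            ((nc : ℝ≥0∞) * γR) ^ (1 / 3 : ℝ)) := by
          rw [ENNReal.mul_rpow_of_nonneg _ _ (by norm_num : (0 : ℝ) ≤ 2 / 3), hcn]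
          gcongr
          exact ENNReal.rpow_add_le_add_rpow _ _ (by norm_num) (by norm_num)
      _ = ENNReal.ofReal B₁ * cn * (((n₄ : ℝ≥0∞) * (nc : ℝ≥0∞)) ^ (1 / 3 : ℝ) * ((n₄ : ℝ≥0∞) * Γ₁) ^ (1 / 3 : ℝ)) *
              γR ^ (2 / 3 : ℝ) +
            ENNReal.ofReal B₁ * cn * (ENNReal.ofReal CL * ((n₄ : ℝ≥0∞) * Γ₁) ^ (2 / 3 : ℝ) * ((nc : ℝ≥0∞) * γR) ^ (1 / 3 : ℝ)) *
              ENNReal.ofReal R⁻¹ := by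
          rw [ENNReal.mul_rpow_of_nonneg _ _ (by norm_num : (0 : ℝ) ≤ 2 / 3),
            ENNReal.mul_rpow_of_nonneg (ENNReal.ofReal _) _ (by norm_num : (0 : ℝ) ≤ 2 / 3), hcL,
            ← ENNReal.rpow_mul, ← ENNReal.rpow_mul,
            ENNReal.mul_rpow_of_nonneg _ γR (by norm_num : (0 : ℝ) ≤ 1 / 2 * (2 / 3)),
            ENNReal.mul_rpow_of_nonneg _ γR (by norm_num : (0 : ℝ) ≤ 1 / 3),
            ENNReal.mul_rpow_of_nonneg (n₄ : ℝ≥0∞) (nc : ℝ≥0∞) (by norm_num : (0 : ℝ) ≤ 1 / 3)]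
          have eγ : γR ^ (1 / 2 * (2 / 3) : ℝ) * γR ^ (1 / 3 : ℝ) = γR ^ (2 / 3 : ℝ) := by
            rw [← ENNReal.rpow_add_of_nonneg _ _ (by norm_num) (by norm_num)]; norm_num
          have en : (n₄ : ℝ≥0∞) ^ (1 / 2 * (2 / 3) : ℝ) = (n₄ : ℝ≥0∞) ^ (1 / 3 : ℝ) := by norm_num
          have eG : ((n₄ : ℝ≥0∞) * Γ₁) ^ (1 / 2 * (2 / 3) : ℝ) = ((n₄ : ℝ≥0∞) * Γ₁) ^ (1 / 3 : ℝ) := by norm_num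
          rw [en, eG]
          calc ENNReal.ofReal B₁ * (cn * ((n₄ : ℝ≥0∞) ^ (1 / 3 : ℝ) * γR ^ (1 / 2 * (2 / 3) : ℝ) * ((n₄ : ℝ≥0∞) * Γ₁) ^ (1 / 3 : ℝ) +
                ENNReal.ofReal CL * ENNReal.ofReal R⁻¹ * ((n₄ : ℝ≥0∞) * Γ₁) ^ (2 / 3 : ℝ)) *
                ((nc : ℝ≥0∞) ^ (1 / 3 : ℝ) * γR ^ (1 / 3 : ℝ)))
              = ENNReal.ofReal B₁ * cn * ((n₄ : ℝ≥0∞) ^ (1 / 3 : ℝ) * (nc : ℝ≥0∞) ^ (1 / 3 : ℝ) * ((n₄ : ℝ≥0∞) * Γ₁) ^ (1 / 3 : ℝ)) *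
                  (γR ^ (1 / 2 * (2 / 3) : ℝ) * γR ^ (1 / 3 : ℝ)) +
                ENNReal.ofReal B₁ * cn * (ENNReal.ofReal CL * ((n₄ : ℝ≥0∞) * Γ₁) ^ (2 / 3 : ℝ) *
                  ((nc : ℝ≥0∞) ^ (1 / 3 : ℝ) * γR ^ (1 / 3 : ℝ))) * ENNReal.ofReal R⁻¹ := by ring
            _ = _ := by rw [eγ]
      _ ≤ k₁ * γR ^ (2 / 3 : ℝ) + k₂ * ENNReal.ofReal R⁻¹ := by
          rw [hk₁, hk₂]
          gcongr
  -- term 2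
  have hterm2 : ∫⁻ τ in Ioo 0 s, ENNReal.ofReal (2 * (C₁ / R)) * ((CN : ℝ≥0∞) * Y τ) ^ (2 / 3 : ℝ) * g₂ τ ^ (1 / 3 : ℝ) ≤
      k₃ * ENNReal.ofReal R⁻¹ := by
    have h1 := hHt (hYm.const_mul (CN : ℝ≥0∞)) hg₂m
    have e : ENNReal.ofReal (2 * (C₁ / R)) = ENNReal.ofReal (2 * C₁) * ENNReal.ofReal R⁻¹ := by
      rw [← ENNReal.ofReal_mul (by positivity), div_eq_mul_inv, mul_assoc]
    calc ∫⁻ τ in Ioo 0 s, ENNReal.ofReal (2 * (C₁ / R)) * ((CN : ℝ≥0∞) * Y τ) ^ (2 / 3 : ℝ) * g₂ τ ^ (1 / 3 : ℝ)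
        = ENNReal.ofReal (2 * (C₁ / R)) * ∫⁻ τ in Ioo 0 s, ((CN : ℝ≥0∞) * Y τ) ^ (2 / 3 : ℝ) * g₂ τ ^ (1 / 3 : ℝ) := by
          rw [← lintegral_const_mul' _ _ ENNReal.ofReal_ne_top]
          refine lintegral_congr fun τ => ?_
          ring
      _ ≤ ENNReal.ofReal (2 * (C₁ / R)) * ((∫⁻ τ in Ioo 0 s, (CN : ℝ≥0∞) * Y τ) ^ (2 / 3 : ℝ) *
            (∫⁻ τ in Ioo 0 s, g₂ τ) ^ (1 / 3 : ℝ)) := mul_le_mul' le_rfl h1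
      _ ≤ ENNReal.ofReal (2 * (C₁ / R)) * (((CN : ℝ≥0∞) * ((n₄ : ℝ≥0∞) * Γ₁)) ^ (2 / 3 : ℝ) *
            ((nc : ℝ≥0∞) * Γ₁) ^ (1 / 3 : ℝ)) := by
          rw [lintegral_const_mul'' _ hYm]
          gcongr
      _ = k₃ * ENNReal.ofReal R⁻¹ := by
          rw [e, hk₃, ENNReal.mul_rpow_of_nonneg _ _ (by norm_num : (0 : ℝ) ≤ 2 / 3), hcn]
          ring
  -- conclude
  calc ∫⁻ τ in Ioo 0 s, Φ τ
      ≤ ∫⁻ τ in Ioo 0 s, (ENNReal.ofReal B₁ * ((CN : ℝ≥0∞) * (X τ + ENNReal.ofReal ((CL / R) ^ (3 / 2 : ℝ)) * Y τ)) ^ (2 / 3 : ℝ) *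
            g₁ τ ^ (1 / 3 : ℝ) +
          ENNReal.ofReal (2 * (C₁ / R)) * ((CN : ℝ≥0∞) * Y τ) ^ (2 / 3 : ℝ) * g₂ τ ^ (1 / 3 : ℝ)) := by
        refine lintegral_mono_ae ?_
        filter_upwards [hslice, hΦ, ae_restrict_mem measurableSet_Ioo] with τ h1 hΦτ h2
        exact (hΦτ h2).trans (h1 h2)
    _ = (∫⁻ τ in Ioo 0 s, ENNReal.ofReal B₁ * ((CN : ℝ≥0∞) * (X τ + ENNReal.ofReal ((CL / R) ^ (3 / 2 : ℝ)) * Y τ)) ^ (2 / 3 : ℝ) *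
            g₁ τ ^ (1 / 3 : ℝ)) +
          ∫⁻ τ in Ioo 0 s, ENNReal.ofReal (2 * (C₁ / R)) * ((CN : ℝ≥0∞) * Y τ) ^ (2 / 3 : ℝ) * g₂ τ ^ (1 / 3 : ℝ) :=
        lintegral_add_left' hT1m _
    _ ≤ (k₁ * γR ^ (2 / 3 : ℝ) + k₂ * ENNReal.ofReal R⁻¹) + k₃ * ENNReal.ofReal R⁻¹ := add_le_add hterm1 hterm2
    _ ≤ K * γR ^ (2 / 3 : ℝ) + K * ENNReal.ofReal R⁻¹ := by
        have h1 : k₁ ≤ K := by rw [hK]; exact le_add_right le_self_add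
        have h2 : k₂ + k₃ ≤ K := by rw [hK, add_assoc]; exact le_add_self
        calc k₁ * γR ^ (2 / 3 : ℝ) + k₂ * ENNReal.ofReal R⁻¹ + k₃ * ENNReal.ofReal R⁻¹
            = k₁ * γR ^ (2 / 3 : ℝ) + (k₂ + k₃) * ENNReal.ofReal R⁻¹ := by ring
          _ ≤ _ := add_le_add (mul_le_mul' h1 le_rfl) (mul_le_mul' h2 le_rfl)
    _ = K * (ENNReal.ofReal R⁻¹ + γR ^ (2 / 3 : ℝ)) := by ring


/-! ### Slices of the near field are measurable -/

/-- For a measurable slice with finite energy on `B(x₀, 2r)`, the near-field pressure slice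
`localPressureNear x₀ r u t` is a.e.-strongly measurable. [folklore] -/
theorem aestronglyMeasurable_localPressureNear_slice {x₀ : EuclideanSpace ℝ (Fin 3)} {r : ℝ}
    {u : ℝ → EuclideanSpace ℝ (Fin 3) → EuclideanSpace ℝ (Fin 3)} {t : ℝ}
    (hum : AEStronglyMeasurable (u t) volume) (hfin : ∫⁻ x in ball x₀ (2 * r), ‖u t x‖ₑ ^ 2 < ⊤) :
    AEStronglyMeasurable (localPressureNear x₀ r u t) volume := by
  set w : EuclideanSpace ℝ (Fin 3) → EuclideanSpace ℝ (Fin 3) := (ball x₀ (2 * r)).indicator (u t) with hw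
  have hq_eq : localPressureNear x₀ r u t = normalisedPressure w := funext fun x => localPressureNear_apply _ _ _ _ _
  have hwm : AEStronglyMeasurable w volume := hum.indicator measurableSet_ball
  have hint : IntegrableOn (fun y => ‖u t y‖ ^ 2) (ball x₀ (2 * r)) volume := by
    refine ⟨(continuous_norm.pow 2).comp_aestronglyMeasurable hum.restrict, ?_⟩
    refine hasFiniteIntegral_iff_enorm.2 ?_
    refine lt_of_le_of_lt (lintegral_mono fun y => le_of_eq ?_) hfin
    rw [Real.enorm_eq_ofReal (sq_nonneg _), ENNReal.ofReal_pow (norm_nonneg _), ofReal_norm]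
  have hw2 : Integrable (fun y => ‖w y‖ ^ 2) volume := by
    have h := hint.integrable_indicator measurableSet_ball
    refine h.congr (Eventually.of_forall fun y => ?_)
    show (ball x₀ (2 * r)).indicator (fun y => ‖u t y‖ ^ 2) y = ‖w y‖ ^ 2
    rw [hw]
    by_cases hy : y ∈ ball x₀ (2 * r)
    · rw [indicator_of_mem hy, indicator_of_mem hy]
    · rw [indicator_of_notMem hy, indicator_of_notMem hy, norm_zero]; ring
  rw [hq_eq]
  exact aestronglyMeasurable_normalisedPressure_of_sq_integrable hwm hw2

end Literature.Analysis.FluidPDE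

end
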